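import Summits.SmoothPoincare4.SmoothPoincare4.Theses.ZeroSurgeryExotic
import Literature.Topology.FourManifolds.Rasmussen
import Literature.Topology.FourManifolds.RasmussenProofs
import Literature.Topology.FourManifolds.DehnSurgeryProofs
import Literature.Topology.FourManifolds.ZeroSurgeryHomotopyBallSliceHolds
import Literature.Topology.FourManifolds.HomotopyBallSliceProofs
import Literature.Barriers.SmoothPoincare4.GluckTwistsDissolve
import Literature.Barriers.SmoothPoincare4.GluckTwistsDissolveRasmussenProofs
import Literature.Uncategorized.Crux
import Literature.Topology.FourManifolds.RasmussenConcordanceProofs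
import Literature.Topology.FourManifolds.KirbyMovesMirrorProofs
import Literature.Topology.FourManifolds.KirbyMovesReverseProofs
import Literature.Topology.FourManifolds.KirbyMovesProofs
import Literature.Topology.FourManifolds.SliceGenusMirrorProofs
import Literature.Topology.FourManifolds.SliceGenusEqZeroIffProofs
import Literature.Topology.FourManifolds.KnotsIsotopyProofs
import Literature.Topology.FourManifolds.ZeroSurgeryHomotopyBallSliceProofs
import Literature.Topology.FourManifolds.SliceDiscInTransport
import Literature.Topology.FourManifolds.HomotopyBallSliceSphereProofs
import Literature.Topology.FourManifolds.SliceRibbonIsotopyProofs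
import Literature.Topology.FourManifolds.ComplexProjectiveSpaceOrientationProofs
import Literature.Topology.FourManifolds.SmoothOrientationConnectedProofs
import Literature.Topology.FourManifolds.OrientedConnectedSumTransportProofs
import Literature.Topology.FourManifolds.OrientedConnectedSumUniqueness

/-!
# Disproof of `ZseSVanishesOnPairs` — findings (cdisprove gen 1 + gen 2 + gen 3 + gen 4, 2026-08-16)

Work file of the standing disprover on crux `ZeroSurgeryExotic.ZseSVanishesOnPairs`
(item `stmt-SmoothPoincare4-0368`, "kill test for crux 2": on a `0`-surgery pair `(K, K')` with
`K` smoothly slice, Rasmussen's `s(K') = 0`).  The route decl is NOT materialised (the route file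
carries it as a TODO comment pending `import Literature.Topology.FourManifolds.LeeRasmussen`); the
ledger signature IS, verbatim, the tree's registered open statement
`Literature.Uncategorized.SVanishesOnPairs` (filed by the sibling disprover of crux 2 via
`Literature/Uncategorized/Crux.lean`), and §0's `Crux` is an `abbrev` for it — every theorem below is
about that tree decl.  Everything is PROVED (rc 0, no `sorry`, axioms propext / Classical.choice /
Quot.sound); prose only in docstrings.  LANDED in the tree (Theorems/ZseSVanishesOnPairs/Negative/):
`LoadBearing.lean` (p73127, = §3), `Position.lean` (p74069, = §2), `Strengthenings.lean` (p74091, = §4),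
`Targets.lean` (= §5); gen 2: `MirrorClosure.lean` (p76282, = §7), `ConcordanceFriends.lean` (p76303, = §§8–9),
`MirrorConsequences.lean` (p76749, = §7b); gen 3: `HeightZero.lean` (p78963, = §12: LEMMA S, height-zero bet ⟺ kill
switch, counterexample / FGMW sphere not of Schoenflies type).
Sibling work file with the mirror-image analysis of crux 2 (`∃`-form):
`Cruxes/ZseCruxRasmussen/Disproof.lean`.  Index:

* §0 `Crux` (= `SVanishesOnPairs` = item 0368), `CruxRasmussen` (= `Literature.Uncategorized.Crux` =
  item 0366), `crux_iff_not_cruxRasmussen` — the crux is literally the negation of crux 2.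
* §1 CALIBRATION `rasmussen_of_crux` — the diagonal `K = K'` of the crux is Rasmussen's slice
  theorem `eq_zero_of_isSmoothlySlice` (a named fact NOT yet discharged in the tree; in-tree twin:
  `Summit.SmoothPoincare4.ZeroSurgeryExotic.eq_zero_of_isSmoothlySlice_of_sVanishesOnPairs`): any proof
  of the crux is in particular a proof of Rasmussen 2010 Thm 1 (genus-0 case).
* §2 WHERE IT SITS: `crux_of_question911` (MMSW Q9.11 ⇒ Crux, via the PROVED MP Lemma 3.3),
  `crux_of_spc4` (Rasmussen ∧ SPC4 ⇒ Crux), `zseThesis_of_not_crux` / `exotic_of_not_crux`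
  (a kill of this crux, given Rasmussen's theorem, is the route's thesis X and an exotic `S⁴`),
  `crux_of_assembly2`.  WHY IT RESISTS: ¬Crux is an exotic 4-sphere; see also §6.
* §3 LOAD-BEARING HYPOTHESES, all UNCONDITIONAL (witnesses: the tree's `unknot`, the positive
  trefoil `torusKnot 2 3` with `s = 2` PROVED in the tree, `exists_isIntegralSurgery_holds`):
  `crux_false_without_slice`, `crux_false_without_invariant`, `crux_false_without_commonSurgery`,
  `crux_false_without_surgeryLeft`, `crux_false_without_surgeryRight`.  (No vacuity: the four
  hypotheses are jointly satisfiable, `crux_false_without_invariant`.)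
* §4 NATURAL STRENGTHENINGS: `cruxTop_false_of_piccirilloConwayPair` (topological sliceness of
  `K` does NOT suffice: Conway knot / Piccirillo's partner, printed), `cruxSZero_false_of_…`
  (`s(K) = 0` does not suffice), `cruxSInvariant_false_of_…` (`s` is not a `0`-surgery — not even a
  `0`-trace — invariant), `cruxFraming_false_of_moserCoincidence` (framing `0` cannot be replaced by
  framing `±5`: `L(5,1)` is `5`-surgery on the unknot AND on the trefoil, Moser 1971).  These are
  modulo the printed pairs as precise `Prop`s (the tree cannot yet construct the Conway knot or
  lens-space surgeries); the unknot/trefoil half is unconditional.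
* §5 TARGETS (lead's line `two-knot-meridional-dual`): the skeleton's local defs `MeridionalDual`,
  `SliceInGluckTwist` are not readable from this seat (evidence store unmounted in the refuter
  jail; `crux write` had been refused to the lead), so the COMPOSITE of stubs 1+2 is attacked:
  `PairsSliceInGluckTwist` (every `K'` `0`-surgery-related to a slice `K` is slice in some Gluck
  twist of `S⁴`).  Proved: `crux_of_pairsSliceInGluckTwist` (with stub 3 = MMSW Cor 1.13 it closes
  the crux), `rasmussen_of_stub3` (stub 3 alone already implies Rasmussen's theorem),
  `isSmoothlySlice_of_isSliceDiscIn_of_diffeomorph` (Palais, per manifold), and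
  `exoticGluckTwist_of_pairsSliceInGluckTwist_of_zseThesis`: IF the lead's lever holds then the
  route's thesis X produces a Gluck twist NOT diffeomorphic to `S⁴` — the line bets the whole
  `0`-surgery programme on Kirby Problem 4.24 having a negative answer.  No kill of the composite
  is available (it is implied by "all 0-surgery-born homotopy spheres are Gluck twists", open).
* §6 WHY IT RESISTS / WHERE A COUNTEREXAMPLE CANNOT BE (docstring `why_it_resists`): printed
  coverage (Gluck-born spheres, (super-)special RBG links, DG's 5·10⁵ pairs), the ribbon
  handle-count remark (K ribbon with `m` minima ⇒ the MP sphere has NO 1-handles, `m` 2-handles,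
  `m` 3-handles: `m = 1` is Property R, so a witness needs fusion number ≥ 1 and a failure of
  "generalised Property R spheres are standard"), and what a search must certify.

GEN 2 ADDITIONS (standing disprover gen 2, 2026-08-16; §§7–11, all rc 0, no `sorry`, standard axioms):

* §7 MIRROR CALCULUS (UNCONDITIONAL, from three PROVED tree facts — `FramedLink.IsSurgery.mirror`,
  `Knot.sliceGenus_mirror_holds` + `Knot.sliceGenus_eq_zero_iff_holds`, `HasRasmussenInvariant.mirror_holds`):
  `isIntegralSurgery_mirror` (`Y` is `m`-surgery on `K` ⇒ `Y` is `(-m)`-surgery on `K̄`), hence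
  `zeroSurgeryPair_self_mirror` — EVERY knot is a `0`-friend of its mirror image in the tree's
  (unoriented) sense: the pair relation of the crux is ORIENTATION-BLIND; `isSmoothlySlice_mirror_iff`;
  and the rigorous ONE-SIDED REDUCTION `crux_iff_cruxNonpos` / `crux_iff_cruxNonneg`: a proof of the
  crux need only show `s(K') ≤ 0` (or only `≥ 0`) on pairs with `K` slice.  For the disprover:
  counterexamples come in mirror pairs (`counterexamples_come_in_mirror_pairs`).  §7b: consequences for
  §4 — `cruxSInvariant_false` is now UNCONDITIONAL (`s` is not a `0`-surgery invariant in the tree's sense: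
  the pair `(T(2,3), T̄(2,3))`, `s = ±2`), and `cruxTop_false_of_sDetectsTopSlice` needs only ONE
  topologically slice knot with `s ≠ 0` (Rasmussen's `Wh⁺(T₂,₃)`), not the Conway/Piccirillo pair.
  §7c: `isIntegralSurgery_reverse` — the pair relation is also blind to the STRING orientation of either
  knot (proved `FramedLink.IsSurgery.reverseComponent'`), and `s(rK) = s(K)` (`HasRasmussenInvariant.reverse_holds`).
* §8 THE 2026 CANDIDATE POOL, formally: `crux_iff_not_sliceConcordanceFriend` (mod Rasmussen's
  concordance invariance) — the crux fails iff some SLICE knot has a `0`-friend CONCORDANT to a knot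
  with `s ≠ 0`; this is exactly the success condition of Kegel–Spreer's Algorithm 6 (arXiv:2603.22438,
  March 2026), whose live, unresolved instances are listed in the docstring of `SliceConcordanceFriend`
  (the 262-crossing friend `W₊''` of a knot concordant to `Wh⁺(T₂,₃)`, `s = 2`; the friends in their
  sets `F4`/`F6` descending from the Conway friends `K1, K2, K3` with `s ≠ 0`; no ribbon certificate
  found for any, 3·10⁴ bands each).  FIRST PRINTED LIVE CANDIDATES against this crux since DG 2025.
* §9 `∀`-FORM vs `∃`-FORM: `hasRasmussenInvariant_unique` and `crux_iff_exists_form`, modulo the two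
  still-UNDISCHARGED well-definedness facts `Knot.reidemeister`, `rasmussenInvariant_eq_of_equiv`
  (existence `exists_hasGaussDiagram_of_isIsotopic` and the isotopy facts ARE discharged now).
* §10 AUDIT OF THE FORMAL STATEMENT (junk-model attacks, all FAILED — do not repeat): `Knot` = honest
  `C^∞` embedding, `IsIsotopic` = ambient diffeotopy, `HasGaussDiagram` = honest regular projection
  (no missing/duplicate/tangential crossings possible), the Gauss-diagram Lee complex and `s` were
  re-implemented symbol-by-symbol in exact arithmetic and VALIDATED on 56 small realisable diagrams
  (all unknot diagrams incl. kinks/R2/stabilisations give `s = 0`; `T(2,3) ↦ 2`, mirror `↦ -2`,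
  `T(2,5) ↦ 4`, `4₁, 6₁ ↦ 0`; evidence `kh/treemodel.py`, `kh/audit_output.txt` on the item), so no
  unknot diagram with `s ≠ 0` exists to fake a witness; `IsIntegralSurgery` = honest open gluing with
  framing read in `π₁ᵃᵇ`; `IsSliceDisc` demands a smooth injective IMMERSION OF THE CLOSED DISC plus
  neatness, which excludes the classical fake "cone from a boundary point" disc that every knot bounds.
  `crux_nonvacuous` records joint satisfiability of all four hypotheses.  Verdict: the formal crux is
  faithful; `¬Crux` is exactly an exotic `S⁴` certified by `s` (§2), nothing cheaper.
* §11 WHY IT RESISTS, 2026 UPDATE: `not_isSmoothlySlice_of_vanishingClass` — the self-destruction of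
  `s`-witnesses (Dunfield–Gong 2025 Thm 5.9 / Table 10: on every class of pairs where the crux is
  already a theorem — super-special RBG presentations — a pair with `s(K') ≠ 0` certifies that `K` is
  NOT slice; 24 of DG's 25 `(unknown, s ≠ 0)` pairs died this way, the 25th by `r = 0` ⇒ equal traces),
  so a crux-2 witness must avoid every Nakamura–Ren class; docstring census of where a counterexample
  can still live.

GEN 3 ADDITIONS (standing disprover gen 3, 2026-08-16; §§12–13, all rc 0, no `sorry`, standard axioms;
new imports `SliceDiscInTransport`, `HomotopyBallSliceSphereProofs`).  Picked line is now
`embed-dont-dissolve` (lead prover-line-stmt-SmoothPoincare4-0368-0; skeleton `Lines/embed-dont-dissolve.lean`,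
six registered stubs, bet = `stub_puncturedPairSphereEmbeds`: punctured Manolescu–Piccirillo pair spheres
embed orientation-correctly in `ℂℙ²`-towers of ONE chirality).  No stuck stubs were handed over (`targets = []`).

* §12 TARGETS FOR THE NEW LINE — HEIGHT ZERO IS THE KILL SWITCH; SCHOENFLIES SPHERES ARE USELESS
  (UNCONDITIONAL): `isSmoothlySlice_of_isSliceDiscIn_of_puncture_embeds_heightZero` / `…_sphere` (LEMMA S:
  slice data for `K` in ANY smooth 4-manifold `X` + a smooth embedding of some puncture `X ∖ {q}` off the
  data into `P ≅ S⁴` ⇒ `K` smoothly slice — corestrict, transport, Palais; so a knot slice in a Schoenflies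
  ball `B ⊂ S⁴`, or in any homotopy ball a puncture of whose sphere embeds in `S⁴`, is slice, WITHOUT the
  Schoenflies conjecture); `HeightZeroBet` (the bet with tower height frozen at `0`, orientations dropped,
  ambient arbitrary) and `heightZeroBet_iff_assembly2` / `heightZeroBet_iff_not_zseThesis` — at height `0`
  the line IS the route's kill switch `Assembly2`, refutable by exactly the thesis X and nothing less, so
  the line's content is the passage to height `≥ 1`; `counterexample_not_schoenflies` (given Rasmussen: the
  MP sphere of a crux counterexample — indeed every ambient 4-manifold of a slice disc for `K'` — has NO
  puncture embedding in `S⁴`); `fgmw_sphere_not_schoenflies` (Barriers form: the FGMW strategy cannot live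
  on spheres `B ∪ B⁴`, `B` a Schoenflies ball); `exists_isSliceDiscIn_puncture_embeds_iff` ("slice in an
  `S⁴`-embeddable punctured ambient" ⟺ slice; `IsHomotopyBallSlice` is that statement minus embeddability).
  JUNK AUDIT of the skeleton's vocabulary (paper): `IsOrientedConnectedSum` enforces orientation
  compatibility (`i₁` preserving, `i₂` reversing, `jA`, `jB` preserving) — were it orientation-blind, a
  height-2 "tower" could be `ℂℙ² # ℂℙ²bar`, in which BOTH `T(2,3)` and `T̄(2,3)` (`s = ±2`) are H-slice
  (`T(2,-3)` is strongly H-slice in `ℂℙ²bar`, MMSW Ex. 6.4, its mirror in `ℂℙ²`, Rem. 6.6, and a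
  null-homologous disc in `Q°` stays null-homologous in `(Q # Q')°`), so `stub_mmswOneSided` would fail for
  either sign; hence the orientation hypotheses of stubs 1c/2/4 are load-bearing, not decoration.  (Norman's
  trick alone does NOT make every knot H-slice in `S² × S²` or `ℂℙ² # ℂℙ²bar`: the disc it produces carries
  the class of the dual sphere it was first tubed into; in the spin `#ⁿ(S² × S²)` the Arf invariant obstructs
  null-homologous discs.)  `SmoothOrientation`/`IsOrientationPreserving` honest (pointwise orientation, chart-local
  constancy); `∃ o` in stubs 1b/3 absorbs both the chirality of the tree's `ℂℙ²` and the knot-mirror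
  convention of `IsSliceDiscIn` (ball chart preserving ⇒ `e|S³` reverses the boundary orientation of `X°`).
  DATUM SLACK (paper): the stub's datum fixes `X ∖ (e(𝔻⁴) ∪ f(𝔻²))` only up to diffeomorphism of OPEN
  manifolds; `H₁ ≅ ℤ` of the open exterior forces the core's regular neighbourhood to be the `0`-trace of
  `K'` and nested collars give an h-cobordism `S³₀(K) ~ S³₀(K')`, hence (Haken) a genuine `0`-surgery pair,
  but `X` may differ from the honest MP sphere by `# Σ` for any homotopy sphere `Σ` ABSORBED by the open
  exterior (`int V # Σ ≅ int V`); with `K = K' = U` the stub then asserts `Σ ∖ pt ↪ #ⁿℂℙ²` for every `Σ`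
  with `(S¹ × ℝ³) # Σ ≅ S¹ × ℝ³` — harmless (no such exotic `Σ` is known; it only says the bet is a shade
  stronger than the MP statement).
* §13 AUDIT OF THE LEAD'S THEOREM A (`Cruxes/…/NOTES.md` = bet-analysis): paper proof checked step by
  step (van Kampen, immersed annulus + fibre cap, Norman trick on parallel copies of the square-0 sphere
  `D ∪ D''`, parity = MP Def. 3.8, blow-up bookkeeping, even case via LEMMA S not Schoenflies, odd case via
  MMSW Cor. 1.9 + Rem. 6.6): NO GAP FOUND; novelty vs the held texts of MP 2023 §3 / Nakamura 2023 §3 /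
  DG 2025 / MMSW: not in print (Nakamura's Lemma 3.5 asks the dual curve to be slice in the 0-handle or in
  an auxiliary closed `W`; no `π₁` hypothesis anywhere); remote indices were unreachable (`search-degraded:
  searchd`).  Formal residue: `IsSmoothlyZSlice`, hypothesis `CorollaryB` (= Theorem A for `π₁(B⁴ ∖ D'') ≅ ℤ`),
  `corollaryB_of_crux`, `counterexample_not_ZSlice` — CENSUS: a crux-2 witness needs its slice knot NOT
  smoothly `ℤ`-slice (no Whitehead double of a slice knot; if `Δ_K = 1`, every smooth slice disc has
  non-abelian group), on top of §6/§11/§12 (not a Gluck twist, outside every Nakamura–Ren class, MP sphere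
  with no `S⁴`-embeddable puncture).

GEN 4 ADDITIONS (standing disprover gen 4, 2026-08-16; §§14–15, rc 0, no `sorry`, standard axioms; new imports
`SliceRibbonIsotopyProofs`, `ComplexProjectiveSpaceOrientationProofs`, `SmoothOrientationConnectedProofs`,
`OrientedConnectedSumTransportProofs`, `OrientedConnectedSumUniqueness`).  Re-armed with `targets = []`, `stuck_stubs = []` (lead at cycle 0 on `embed-dont-dissolve`, stubs
1a/1c/2/4 landed, live stubs = the bet 1b and the engine 3, both attacked in §12 / drefute report and
irrefutable short of an exotic `S⁴`).  This generation's attack was the route's own CHEAPEST FALSIFIER — a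
literature sweep for an answer to MMSW Q9.11 or a new `(slice, s ≠ 0)` pair (gen 3 was search-degraded) — plus
one new formal vanishing class (§14) and the formal bi-chirality of the picked line's bet (§15):

* §14 SEEDS WITH A CHARACTERISING `0`-SLOPE (`IsZeroCharacterised K`: every `0`-friend of `K` in the
  crux's orientation-blind sense is isotopic to `K` or `K̄`): `isSmoothlySlice_partner_of_zeroCharacterised`
  (UNCONDITIONAL: on this class the kill switch `Assembly2` holds — the partner is slice) and
  `zseThesis_seed_not_zeroCharacterised` (the route's THESIS cannot be seeded there either),
  `crux_on_zeroCharacterised` (mod Rasmussen only), `IsZeroCharacterised.mirror` (unconditional),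
  `zeroCharacterised_vanishingClass`, `counterexample_seed_not_zeroCharacterised`,
  `isZeroCharacterised_unknot_of` (Property R as the degenerate instance).  PRINTED INSTANCES: Baldwin–Sivek 2024 Thm. 1.1 — `0` characterises the slice
  pretzel knots `P(-3,3,2n+1)` for every `n` (and `15n43522`, `Wh±(T₂,₃,2)`, `5₂`, `U`, `3₁`, `4₁`): the
  first infinite family of non-trivial slice knots provably useless as seeds, by a Floer-theoretic
  Dehn-surgery-characterisation mechanism absent from §§6, 11, 13.  LITERATURE CENSUS 2025–26 (docstring
  of `crux_implies_every_vanishingClass`): Q9.11 still open; new supply family outside the Nakamura–Ren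
  classes = Qin's peculiar RBG links (AGT 2025, arXiv:2308.04681 §4; printed examples have `σ(K_B) = 2`,
  no slice member); Ren–Willis Prop. 6.17 / Nahm 2026 give no homotopy-ball vanishing beyond dissolution
  (they detect exotic TRACES); Diao–Pan–Yan 2026 GST experiments support "fusion-number-1 seeds give
  standard spheres"; Kegel–Spreer's 2026 candidates (§8) have no follow-up.  WHY IT RESISTS, unchanged:
  `¬Crux` is an exotic `S⁴` certified by `s` (§2); every printed mechanism either forces `s(K') = 0` or
  kills the sliceness of `K` (§11), and the live candidates need a ribbon certificate nobody has found.
* §15 THE LINE'S `∃ o` IS COSMETIC (drefute Remark 1 FORMALISED at the pair level the composition consumes;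
  UNCONDITIONAL): over verbatim copies of the skeleton's `IsTower` / `PuncturedEmbedsInTower` /
  `PairSphereEmbeds`, `pairSphereEmbeds_mirror_iff` (`PairSphereEmbeds o K̄' ↔ PairSphereEmbeds (-o) K'`:
  reflect the ball chart — `Knot.IsSliceDiscIn.mirror` + the lead's landed mirror-chart lemma, inlined —
  and read the punctured embedding into `(P, oP)` as one of `(X, -oX)` into the `(-o)`-tower `(P, -oP)`),
  hence `pairSpheresEmbedIn_neg_iff` (the planner's stub 1 for `o` ⟺ for `-o`, via the mirror pair of §7)
  and `exists_pairSpheresEmbedIn_iff_forall` (`(∃ o, bet o) ↔ (∀ o, bet o)`, `ℂℙ²` connected).  So any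
  proof of stub 1 embeds every pair sphere punctured in towers of BOTH chiralities, a wrong-chirality pair
  kills the bet for both `o` at once, and the case split `o₁ = ±o₀` in `sVanishesOnPairs_of_stubs` is
  bookkeeping: the engine (stub 3) may be fed its own chirality.
-/

noncomputable section

set_option linter.dupNamespace false

open scoped Manifold ContDiff Topology
open Set Function ContinuousMap
open Literature.Topology.FourManifolds

namespace Summit.SmoothPoincare4.SmoothPoincare4.Cruxes.ZseSVanishesOnPairs.Disproof

open Summit.SmoothPoincare4.SmoothPoincare4.Theses.ZeroSurgeryExotic

/-- Local notation: the model space `ℝⁿ`. -/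
local notation "𝔼 " n:arg => EuclideanSpace ℝ (Fin n)
/-- Local notation: the round 4-sphere. -/
local notation "𝕊⁴" => (Metric.sphere (0 : EuclideanSpace ℝ (Fin 5)) 1)

/-! ## §0 The crux restated by name; it is `¬` crux 2 -/

/-- **The crux** = the tree's registered open statement `Literature.Uncategorized.SVanishesOnPairs`
(ledger signature of `stmt-SmoothPoincare4-0368`, verbatim): for knots `K, K'` with a common
`0`-surgery `Y`, `K` smoothly slice, every Rasmussen invariant `s` of `K'` is `0`.
[cite: ManolescuMarengonSarkarWillis2023, Question 9.11] -/
abbrev Crux : Prop := Literature.Uncategorized.SVanishesOnPairs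

/-- **Crux 2 of the route** = `Literature.Uncategorized.Crux` (ledger signature of
`stmt-SmoothPoincare4-0366`, verbatim): a `0`-surgery pair with `K` slice and `s(K') ≠ 0`.
[cite: ManolescuPiccirillo2023, §1 p. 1] -/
abbrev CruxRasmussen : Prop := Literature.Uncategorized.Crux

/-- Unfolding of `Crux` (for readers: the verbatim signature). [folklore] -/
theorem crux_iff : Crux ↔
    ∀ (K K' : Knot) (Y : Type) [TopologicalSpace Y] [ChartedSpace (𝔼 3) Y] (s : ℤ),
      IsIntegralSurgery (𝓡 3) Y K 0 → IsIntegralSurgery (𝓡 3) Y K' 0 → K.IsSmoothlySlice →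
        K'.HasRasmussenInvariant s → s = 0 := Iff.rfl

/-- Unfolding of `CruxRasmussen`. [folklore] -/
theorem cruxRasmussen_iff : CruxRasmussen ↔
    ∃ (K K' : Knot) (Y : Type) (_ : TopologicalSpace Y) (_ : ChartedSpace (𝔼 3) Y) (s : ℤ),
      IsIntegralSurgery (𝓡 3) Y K 0 ∧ IsIntegralSurgery (𝓡 3) Y K' 0 ∧ K.IsSmoothlySlice ∧
        K'.HasRasmussenInvariant s ∧ s ≠ 0 := Iff.rfl

/-- The crux is literally the negation of crux 2 (pure logic). [folklore] -/
theorem crux_iff_not_cruxRasmussen : Crux ↔ ¬ CruxRasmussen := by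
  constructor
  · rintro h ⟨K, K', Y, _, _, s, h1, h2, h3, h4, h5⟩
    exact h5 (h K K' Y s h1 h2 h3 h4)
  · intro h K K' Y _ _ s h1 h2 h3 h4
    by_contra h5
    exact h ⟨K, K', Y, _, _, s, h1, h2, h3, h4, h5⟩

/-- A disproof of the crux is exactly a witness of crux 2. [folklore] -/
theorem not_crux_iff_cruxRasmussen : ¬ Crux ↔ CruxRasmussen := by
  rw [crux_iff_not_cruxRasmussen, not_not]

/-! ## §1 Calibration: the diagonal `K = K'` is Rasmussen's slice theorem -/

/-- **Any proof of the crux proves Rasmussen's theorem** `s(K) = 0` for smoothly slice `K`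
(the tree's named fact `eq_zero_of_isSmoothlySlice`, Rasmussen 2010 Thm 1, NOT discharged in the
tree as of 2026-08-16): take `K' = K` and `Y` the `0`-surgery on `K`, which exists
(`exists_isIntegralSurgery_holds`). [cite: Rasmussen2010, Thm. 1] -/
theorem rasmussen_of_crux (h : Crux) : eq_zero_of_isSmoothlySlice := by
  intro K s hs hK
  obtain ⟨Y, _, _, _, _, _, _, hY⟩ := exists_isIntegralSurgery_holds K 0
  exact h K K Y s hY hY hK hs

/-! ## §2 Where the crux sits: `SPC4 ⇒ Q9.11 ⇒ Crux ⇒ Rasmussen`; `¬Crux ⇒ exotic S⁴` -/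

/-- Manolescu–Piccirillo Lemma 3.3 (`W = S⁴`), PROVED in the tree, in the vocabulary of the crux:
on a `0`-surgery pair with `K` slice, `K'` is slice in a homotopy 4-ball.
[cite: ManolescuPiccirillo2023, Lemma 3.3] -/
theorem isHomotopyBallSlice_of_pair {K K' : Knot} {Y : Type} [TopologicalSpace Y]
    [ChartedSpace (𝔼 3) Y] (h1 : IsIntegralSurgery (𝓡 3) Y K 0)
    (h2 : IsIntegralSurgery (𝓡 3) Y K' 0) (h3 : K.IsSmoothlySlice) : K'.IsHomotopyBallSlice :=
  Literature.Uncategorized.isHomotopyBallSlice_of_zeroSurgeryPair h1 h2 h3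

/-- **MMSW Question 9.11 (knots) implies the crux**: the crux is the restriction of Q9.11 to the
homotopy balls born from `0`-surgery pairs. [cite: ManolescuMarengonSarkarWillis2023, Question 9.11] -/
theorem crux_of_question911 (hQ : Literature.Barriers.SmoothPoincare4.MMSW2023Question911Knot) :
    Crux :=
  Literature.Uncategorized.sVanishesOnPairs_of_mmsw2023Question911Knot hQ

/-- Under SPC4 every homotopy-ball-slice knot is slice (FGMW lemma, PROVED in the tree via Palais).
[cite: FreedmanGompfMorrisonWalker2010, §1] -/
theorem isSmoothlySlice_of_isHomotopyBallSlice_of_spc4 (hS : _root_.SmoothPoincare4) {K : Knot}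
    (hK : K.IsHomotopyBallSlice) : K.IsSmoothlySlice := by
  by_contra hns
  obtain ⟨M, i₁, i₂, i₃, i₄, i₅, i₆, ⟨e⟩, hE⟩ :=
    Knot.exists_exotic_of_isHomotopyBallSlice_not_isSmoothlySlice_holds ⟨K, hK, hns⟩
  obtain ⟨d⟩ := hS M i₄ i₅ e
  exact hE.false d

/-- **SPC4 and Rasmussen's theorem imply the crux.** [cite: ManolescuPiccirillo2023, §1 p. 1] -/
theorem crux_of_spc4 (hR : eq_zero_of_isSmoothlySlice) (hS : _root_.SmoothPoincare4) : Crux :=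
  fun _ _ _ _ _ _ h1 h2 h3 h4 ↦
    hR h4 (isSmoothlySlice_of_isHomotopyBallSlice_of_spc4 hS (isHomotopyBallSlice_of_pair h1 h2 h3))

/-- **WHY IT RESISTS (i)**: given Rasmussen's theorem, a disproof of the crux refutes SPC4.
[cite: ManolescuPiccirillo2023, §1 p. 1] -/
theorem not_spc4_of_not_crux (hR : eq_zero_of_isSmoothlySlice) (h : ¬ Crux) :
    ¬ _root_.SmoothPoincare4 :=
  fun hS ↦ h (crux_of_spc4 hR hS)

/-- **WHY IT RESISTS (ii)**: given Rasmussen's theorem, a disproof of the crux proves the route's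
TARGET `ZseThesis` (a `0`-surgery pair, `K` slice, `K'` not slice). [cite: ManolescuPiccirillo2023, §1 p. 1] -/
theorem zseThesis_of_not_crux (hR : eq_zero_of_isSmoothlySlice) (h : ¬ Crux) : ZseThesis := by
  obtain ⟨K, K', Y, _, _, s, h1, h2, h3, h4, h5⟩ := not_crux_iff_cruxRasmussen.1 h
  exact ⟨K, K', Y, _, _, h1, h2, h3, fun h6 ↦ h5 (hR h4 h6)⟩

/-- **WHY IT RESISTS (iii)**: given Rasmussen's theorem, a disproof of the crux exhibits a closed
smooth 4-manifold homotopy equivalent but not diffeomorphic to `S⁴`.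
[cite: FreedmanGompfMorrisonWalker2010, §1] -/
theorem exotic_of_not_crux (hR : eq_zero_of_isSmoothlySlice) (h : ¬ Crux) :
    ∃ (M : Type) (_ : TopologicalSpace M) (_ : T2Space M) (_ : SecondCountableTopology M)
      (_ : ChartedSpace (𝔼 4) M) (_ : IsManifold (𝓡 4) ∞ M) (_ : CompactSpace M),
      Nonempty (M ≃ₕ 𝕊⁴) ∧ IsEmpty (M ≃ₘ⟮𝓡 4, 𝓡 4⟯ 𝕊⁴) := by
  obtain ⟨K, K', Y, _, _, h1, h2, h3, h4⟩ := zseThesis_of_not_crux hR h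
  exact Knot.exists_exotic_of_isHomotopyBallSlice_not_isSmoothlySlice_holds
    ⟨K', isHomotopyBallSlice_of_pair h1 h2 h3, h4⟩

/-- The route's kill switch `Assembly2` (0-surgery type determines sliceness) is literally
`¬ ZseThesis`. [folklore] -/
theorem assembly2_iff_not_zseThesis : Assembly2 ↔ ¬ ZseThesis := by
  constructor
  · rintro hA ⟨K, K', Y, _, _, h1, h2, h3, h4⟩
    exact h4 (hA K K' Y h1 h2 h3)
  · intro h K K' Y _ _ h1 h2 h3
    by_contra h4
    exact h ⟨K, K', Y, _, _, h1, h2, h3, h4⟩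

/-- `Assembly2` and Rasmussen's theorem imply the crux (the positive side's toe-hold kills crux 2
too). [folklore] -/
theorem crux_of_assembly2 (hR : eq_zero_of_isSmoothlySlice) (hA : Assembly2) : Crux :=
  fun K K' Y _ _ _ h1 h2 h3 h4 ↦ hR h4 (hA K K' Y h1 h2 h3)

/-! ## §3 Load-bearing hypotheses (unconditional witnesses) -/

/-- The positive (right-handed) trefoil `T(2,3)` of the tree (`torusKnot 2 3`). [folklore] -/
abbrev trefoil : Knot := torusKnot 2 3 le_rfl (by norm_num) (by decide)

/-- `s(T(2,3)) = 2`, PROVED in the tree (`hasRasmussenInvariant_torusKnot_holds`, computed from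
Lee's complex of the standard positive diagram). [cite: Rasmussen2010, Thm. 4] -/
theorem hasRasmussenInvariant_trefoil : trefoil.HasRasmussenInvariant 2 := by
  have h := hasRasmussenInvariant_torusKnot_holds 2 3 le_rfl (by norm_num) (by decide)
  norm_num at h
  exact h

/-- The crux WITHOUT the hypothesis `K.IsSmoothlySlice`. [folklore] -/
def CruxWithoutSlice : Prop :=
  ∀ (K K' : Knot) (Y : Type) [TopologicalSpace Y] [ChartedSpace (𝔼 3) Y] (s : ℤ),
    IsIntegralSurgery (𝓡 3) Y K 0 → IsIntegralSurgery (𝓡 3) Y K' 0 →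
      K'.HasRasmussenInvariant s → s = 0

/-- **Sliceness of `K` is load-bearing**: without it the statement fails at `K = K' = T(2,3)`,
`Y = S³₀(T(2,3))`, `s = 2`. Unconditional. [cite: Rasmussen2010, Thm. 4] -/
theorem crux_false_without_slice : ¬ CruxWithoutSlice := by
  intro h
  obtain ⟨Y, _, _, _, _, _, _, hY⟩ := exists_isIntegralSurgery_holds trefoil 0
  have h2 := h trefoil trefoil Y 2 hY hY hasRasmussenInvariant_trefoil
  norm_num at h2

/-- The crux WITHOUT the hypothesis `K'.HasRasmussenInvariant s` (the integer `s` unconstrained).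
[folklore] -/
def CruxWithoutInvariant : Prop :=
  ∀ (K K' : Knot) (Y : Type) [TopologicalSpace Y] [ChartedSpace (𝔼 3) Y] (s : ℤ),
    IsIntegralSurgery (𝓡 3) Y K 0 → IsIntegralSurgery (𝓡 3) Y K' 0 → K.IsSmoothlySlice → s = 0

/-- **The invariant hypothesis is load-bearing** (and the other hypotheses are jointly
satisfiable): `K = K' =` unknot, `Y = S³₀(U)`, `s = 1`. Unconditional. [folklore] -/
theorem crux_false_without_invariant : ¬ CruxWithoutInvariant := by
  intro h
  obtain ⟨Y, _, _, _, _, _, _, hY⟩ := exists_isIntegralSurgery_holds unknot 0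
  exact one_ne_zero (h unknot unknot Y 1 hY hY isSmoothlySlice_unknot)

/-- The crux WITHOUT the common `0`-surgery (no relation between `K` and `K'`). [folklore] -/
def CruxWithoutCommonSurgery : Prop :=
  ∀ (K K' : Knot) (s : ℤ), K.IsSmoothlySlice → K'.HasRasmussenInvariant s → s = 0

/-- **The common `0`-surgery is load-bearing**: `K =` unknot (slice), `K' = T(2,3)` (`s = 2`).
Unconditional. [cite: Rasmussen2010, Thm. 4] -/
theorem crux_false_without_commonSurgery : ¬ CruxWithoutCommonSurgery := fun h ↦
  two_ne_zero (h unknot trefoil 2 isSmoothlySlice_unknot hasRasmussenInvariant_trefoil)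

/-- The crux with ONLY `K`'s surgery hypothesis kept (drop `IsIntegralSurgery Y K' 0`). [folklore] -/
def CruxWithoutSurgeryRight : Prop :=
  ∀ (K K' : Knot) (Y : Type) [TopologicalSpace Y] [ChartedSpace (𝔼 3) Y] (s : ℤ),
    IsIntegralSurgery (𝓡 3) Y K 0 → K.IsSmoothlySlice → K'.HasRasmussenInvariant s → s = 0

/-- **`K'`'s surgery hypothesis is load-bearing**: `K =` unknot, `Y = S³₀(U)`, `K' = T(2,3)`.
Unconditional. [cite: Rasmussen2010, Thm. 4] -/
theorem crux_false_without_surgeryRight : ¬ CruxWithoutSurgeryRight := by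
  intro h
  obtain ⟨Y, _, _, _, _, _, _, hY⟩ := exists_isIntegralSurgery_holds unknot 0
  exact two_ne_zero (h unknot trefoil Y 2 hY isSmoothlySlice_unknot hasRasmussenInvariant_trefoil)

/-- The crux with ONLY `K'`'s surgery hypothesis kept (drop `IsIntegralSurgery Y K 0`). [folklore] -/
def CruxWithoutSurgeryLeft : Prop :=
  ∀ (K K' : Knot) (Y : Type) [TopologicalSpace Y] [ChartedSpace (𝔼 3) Y] (s : ℤ),
    IsIntegralSurgery (𝓡 3) Y K' 0 → K.IsSmoothlySlice → K'.HasRasmussenInvariant s → s = 0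

/-- **`K`'s surgery hypothesis is load-bearing**: `K =` unknot, `K' = T(2,3)`, `Y = S³₀(T(2,3))`.
Unconditional. [cite: Rasmussen2010, Thm. 4] -/
theorem crux_false_without_surgeryLeft : ¬ CruxWithoutSurgeryLeft := by
  intro h
  obtain ⟨Y, _, _, _, _, _, _, hY⟩ := exists_isIntegralSurgery_holds trefoil 0
  exact two_ne_zero (h unknot trefoil Y 2 hY isSmoothlySlice_unknot hasRasmussenInvariant_trefoil)

/-- Each dropped-hypothesis variant is implied by the crux's negation being false, i.e. the crux
implies none of them is needed MORE than stated: the crux itself follows from each variant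
(monotonicity, recorded for the census). [folklore] -/
theorem crux_of_cruxWithoutSlice (h : CruxWithoutSlice) : Crux :=
  fun K K' Y _ _ s h1 h2 _ h4 ↦ h K K' Y s h1 h2 h4

/-! ## §4 Natural strengthenings, refuted in print (modulo the printed pairs as precise Props) -/

/-- **Topological variant of the crux**: `K` only TOPOLOGICALLY slice. [folklore] -/
def CruxTop : Prop :=
  ∀ (K K' : Knot) (Y : Type) [TopologicalSpace Y] [ChartedSpace (𝔼 3) Y] (s : ℤ),
    IsIntegralSurgery (𝓡 3) Y K 0 → IsIntegralSurgery (𝓡 3) Y K' 0 → K.IsTopologicallySlice →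
      K'.HasRasmussenInvariant s → s = 0

/-- **`s(K) = 0` variant of the crux**: the sliceness of `K` weakened to `s(K) = 0`. [folklore] -/
def CruxSZero : Prop :=
  ∀ (K K' : Knot) (Y : Type) [TopologicalSpace Y] [ChartedSpace (𝔼 3) Y] (s : ℤ),
    IsIntegralSurgery (𝓡 3) Y K 0 → IsIntegralSurgery (𝓡 3) Y K' 0 → K.HasRasmussenInvariant 0 →
      K'.HasRasmussenInvariant s → s = 0

/-- **`s` a `0`-surgery invariant** (no sliceness at all: `s(K) = s(K')` on `0`-surgery pairs).
[folklore] -/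
def CruxSInvariant : Prop :=
  ∀ (K K' : Knot) (Y : Type) [TopologicalSpace Y] [ChartedSpace (𝔼 3) Y] (s t : ℤ),
    IsIntegralSurgery (𝓡 3) Y K 0 → IsIntegralSurgery (𝓡 3) Y K' 0 → K.HasRasmussenInvariant t →
      K'.HasRasmussenInvariant s → s = t

/-- HYPOTHESIS `H_Picc` — **the Conway / Piccirillo pair as tree objects** (not constructible in the
tree today: no Conway knot, no Kirby-calculus certificate of the common `0`-trace): knots `C`
(the Conway knot `11n34`) and `K'` (Piccirillo's knot) with a common `0`-surgery — they even have
diffeomorphic `0`-traces, `X₀(C) ≅ X₀(K')` (Piccirillo 2020, Prop 1.4; common boundary `S³₀`) — with `C` topologically slice (Alexander polynomial `1`, Freedman 1982;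
Freedman–Quinn 11.7B), `s(C) = 0` (all classical and Heegaard–Floer/Khovanov concordance invariants
of `C` vanish — KnotInfo; this is why its sliceness stayed open until 2018) and `s(K') = 2`
(Piccirillo 2020, Thm 1.5, computed in §4 from Bar-Natan's FastKh and the Lee spectral sequence). [cite: Piccirillo2020, Prop. 1.4, Thm. 1.5 and §4] -/
def PiccirilloConwayPair : Prop :=
  ∃ (C K' : Knot) (Y : Type) (_ : TopologicalSpace Y) (_ : ChartedSpace (𝔼 3) Y),
    IsIntegralSurgery (𝓡 3) Y C 0 ∧ IsIntegralSurgery (𝓡 3) Y K' 0 ∧ C.IsTopologicallySlice ∧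
      C.HasRasmussenInvariant 0 ∧ K'.HasRasmussenInvariant 2

/-- **SMOOTH sliceness of `K` is essential: the topological variant of the crux is FALSE in
print** (Conway knot `C`, top. slice, and Piccirillo's `K'`, `s(K') = 2 ≠ 0`, share their
`0`-surgery — indeed their `0`-trace). So any proof of the crux must use an input that separates
smoothly slice knots from `C` (top. slice, `Δ = 1`, `s = τ = ε = 0`): a genuinely smooth 4-D
datum, not a package of concordance invariants of `K`. [cite: Piccirillo2020, Prop. 1.4, Thm. 1.5 and §4] -/
theorem cruxTop_false_of_piccirilloConwayPair (hP : PiccirilloConwayPair) : ¬ CruxTop := by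
  rintro h
  obtain ⟨C, K', Y, _, _, h1, h2, h3, -, h5⟩ := hP
  exact two_ne_zero (h C K' Y 2 h1 h2 h3 h5)

/-- **`s(K) = 0` does not suffice either** (same pair: `s(C) = 0`, `s(K') = 2`).
[cite: Piccirillo2020, Prop. 1.4, Thm. 1.5 and §4] -/
theorem cruxSZero_false_of_piccirilloConwayPair (hP : PiccirilloConwayPair) : ¬ CruxSZero := by
  rintro h
  obtain ⟨C, K', Y, _, _, h1, h2, -, h4, h5⟩ := hP
  exact two_ne_zero (h C K' Y 2 h1 h2 h4 h5)

/-- **`s` is not a `0`-surgery invariant** (not even a `0`-trace invariant: same pair; also the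
five Manolescu–Piccirillo pairs, `s(K) = 0`, `s(K') = 2`, MP 2023 Thm 1.3/§5).
[cite: Piccirillo2020, Prop. 1.4 and Thm. 1.5] [cite: ManolescuPiccirillo2023, Thm. 1.3] -/
theorem cruxSInvariant_false_of_piccirilloConwayPair (hP : PiccirilloConwayPair) :
    ¬ CruxSInvariant := by
  rintro h
  obtain ⟨C, K', Y, _, _, h1, h2, -, h4, h5⟩ := hP
  have := h C K' Y 2 0 h1 h2 h4 h5
  norm_num at this

/-- The three strengthenings ARE strengthenings (each implies the crux; for `CruxTop` modulo the
named fact "smoothly slice ⇒ topologically slice", `IsSmoothlySlice.isTopologicallySlice`).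
[folklore] -/
theorem crux_of_cruxTop (hst : Knot.IsSmoothlySlice.isTopologicallySlice) (h : CruxTop) : Crux :=
  fun K K' Y _ _ s h1 h2 h3 h4 ↦ h K K' Y s h1 h2 (hst h3) h4

/-- `CruxSZero ⇒ Crux`, modulo Rasmussen's theorem (to get `s(K) = 0` from sliceness one needs
SOME Rasmussen invariant of `K`: existence is the named fact `exists_hasGaussDiagram_of_isIsotopic`,
here bypassed by asking `CruxSZero` only of knots `K` that have `s(K) = 0`). [folklore] -/
theorem crux_of_cruxSZero (hR : eq_zero_of_isSmoothlySlice)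
    (hex : Knot.exists_hasGaussDiagram_of_isIsotopic) (h : CruxSZero) : Crux := by
  intro K K' Y _ _ s h1 h2 h3 h4
  obtain ⟨K₀, D, hK₀, hD⟩ := hex K
  have hK : K.HasRasmussenInvariant D.rasmussenInvariant := ⟨K₀, D, hK₀, hD, rfl⟩
  have h0 : D.rasmussenInvariant = 0 := hR hK h3
  exact h K K' Y s h1 h2 (h0 ▸ hK) h4

/-- `CruxSInvariant ⇒ CruxSZero` (pure logic). [folklore] -/
theorem cruxSZero_of_cruxSInvariant (h : CruxSInvariant) : CruxSZero :=
  fun K K' Y _ _ s h1 h2 h3 h4 ↦ h K K' Y s 0 h1 h2 h3 h4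

/-- **The crux at a general common framing `m`** (`m = 0` is the crux). [folklore] -/
def CruxFraming (m : ℤ) : Prop :=
  ∀ (K K' : Knot) (Y : Type) [TopologicalSpace Y] [ChartedSpace (𝔼 3) Y] (s : ℤ),
    IsIntegralSurgery (𝓡 3) Y K m → IsIntegralSurgery (𝓡 3) Y K' m → K.IsSmoothlySlice →
      K'.HasRasmussenInvariant s → s = 0

/-- Framing `0` is the crux. [folklore] -/
theorem cruxFraming_zero_iff : CruxFraming 0 ↔ Crux := Iff.rfl

/-- HYPOTHESIS `H_Moser m` — **a common `m`-surgery of the unknot and the trefoil** as tree objects: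
some `3`-manifold `Y` is `m`-surgery on the unknot and on `T(2,3)`. TRUE in print for `m = 5` (and
`7`): `5`-surgery on the positive trefoil is the lens space `L(5, 4) ≅ L(5, 1) = S³₅(U)` (unoriented;
Moser 1971: surgery `pq ∓ 1` on `T(p,q)` gives `L(pq ∓ 1, q²)`; the tree's `IsIntegralSurgery` is
orientation-blind); under the opposite sign convention for framings read `m = -5`. Not
constructible in the tree today (no lens spaces, no Moser/Kirby-calculus identification).
[cite: Moser1971] -/
def MoserCoincidence (m : ℤ) : Prop :=
  ∃ (Y : Type) (_ : TopologicalSpace Y) (_ : ChartedSpace (𝔼 3) Y),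
    IsIntegralSurgery (𝓡 3) Y unknot m ∧ IsIntegralSurgery (𝓡 3) Y trefoil m

/-- **Framing `0` is essential**: at any framing `m` where the unknot and the trefoil share an
`m`-surgery (Moser: `m = 5`, lens space `L(5,1)`), the framing-`m` variant of the crux is FALSE
(`K =` unknot slice, `s(T(2,3)) = 2`). At `m = 0` this cannot happen (Gabai's Property R: only the
unknot has `0`-surgery `S¹ × S²`) — the crux uses framing `0` exactly through the MP homotopy-sphere
construction. [cite: Moser1971] -/
theorem cruxFraming_false_of_moserCoincidence {m : ℤ} (hM : MoserCoincidence m) :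
    ¬ CruxFraming m := by
  rintro h
  obtain ⟨Y, _, _, hU, hT⟩ := hM
  exact two_ne_zero (h unknot trefoil Y 2 hU hT isSmoothlySlice_unknot hasRasmussenInvariant_trefoil)

/-! ## §5 Targets: the lead's line `two-knot-meridional-dual` (composite of its stubs) -/

/-- **Slice in some Gluck twist of `S⁴`** (this seat's rendering of the line's transfer target
`SliceInGluckTwist K`, whose skeleton-local definition is not readable here): for some 2-knot `K₂`
and some smooth (Hausdorff, second countable) `X` that is a Gluck twist of `S⁴` along `K₂`, the knot
`K` bounds a smooth proper disc in `X ∖ e(B̊⁴)`. Binders copied from stub 3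
(`stub_mmswGluckVanishing` = the barrier fact `rasmussen_eq_zero_of_isSliceDiscIn_gluckTwist`).
[cite: ManolescuMarengonSarkarWillis2023, Cor. 1.13] -/
def SliceInSomeGluckTwist (K : Knot) : Prop :=
  ∃ (K₂ : TwoKnot) (X : Type) (_ : TopologicalSpace X) (_ : T2Space X)
    (_ : SecondCountableTopology X) (_ : ChartedSpace (𝔼 4) X) (_ : IsManifold (𝓡 4) ∞ X),
    IsGluckTwist (𝓡 4) X K₂ ∧ ∃ (e : 𝔼 4 → X) (f : 𝔼 2 → X), K.IsSliceDiscIn X e f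

/-- **The composite lever of the line** (stub 1 `stub_pairsMeridional` ∘ stub 2
`stub_meridionalDualEngine`): on every `0`-surgery pair with `K` slice, `K'` is slice in some Gluck
twist of `S⁴`. [folklore] -/
def PairsSliceInGluckTwist : Prop :=
  ∀ (K K' : Knot) (Y : Type) [TopologicalSpace Y] [ChartedSpace (𝔼 3) Y],
    IsIntegralSurgery (𝓡 3) Y K 0 → IsIntegralSurgery (𝓡 3) Y K' 0 → K.IsSmoothlySlice →
      SliceInSomeGluckTwist K'

/-- Sanity (the line's assembly in this seat's rendering): the composite lever plus stub 3 (MMSW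
Cor 1.13, the barrier fact) prove the crux. [cite: ManolescuMarengonSarkarWillis2023, Cor. 1.13] -/
theorem crux_of_pairsSliceInGluckTwist (hG : PairsSliceInGluckTwist)
    (hM : Literature.Barriers.SmoothPoincare4.rasmussen_eq_zero_of_isSliceDiscIn_gluckTwist) :
    Crux := by
  intro K K' Y _ _ s h1 h2 h3 h4
  obtain ⟨K₂, X, _, _, _, _, _, hX, e, f, hf⟩ := hG K K' Y h1 h2 h3
  exact hM K₂ X hX K' e f hf s h4

/-- **Stub 3 alone already implies Rasmussen's theorem** (`S⁴` is the Gluck twist along the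
unknotted 2-sphere; tree lemma of the barrier's proof file). So the line, like every proof of the
crux (§1), carries Rasmussen 2010 Thm 1 inside it. [cite: ManolescuMarengonSarkarWillis2023, Cor. 1.13] -/
theorem rasmussen_of_stub3
    (hM : Literature.Barriers.SmoothPoincare4.rasmussen_eq_zero_of_isSliceDiscIn_gluckTwist) :
    eq_zero_of_isSmoothlySlice :=
  Literature.Barriers.SmoothPoincare4.rasmussen_eq_zero_of_isSliceDiscIn_gluckTwist.eq_zero_of_isSmoothlySlice
    hM

/-- **Palais, per manifold** (assembled from the tree's proved `palais_ballComplement_sphere_four`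
and neatening): a knot bounding a smooth proper disc off a ball in a smooth 4-manifold `M` that IS
diffeomorphic to `S⁴` is smoothly slice. [cite: Palais1960, Thm. B] -/
theorem isSmoothlySlice_of_isSliceDiscIn_of_diffeomorph {K : Knot} {M : Type} [TopologicalSpace M]
    [ChartedSpace (𝔼 4) M] [IsManifold (𝓡 4) ∞ M] {e : 𝔼 4 → M} {f : 𝔼 2 → M}
    (h : K.IsSliceDiscIn M e f) (φ : M ≃ₘ⟮𝓡 4, 𝓡 4⟯ 𝕊⁴) : K.IsSmoothlySlice := by
  have h' := h.diffeomorph_comp φ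
  obtain ⟨U, c, hc₁, hc₂⟩ :=
    Knot.palais_ballComplement_sphere_four_holds (φ ∘ e) h'.isSmoothEmbedding
  obtain ⟨g, hg⟩ := h'.exists_isProperDisc c hc₁ hc₂
  exact Knot.isSmoothlySlice_of_isProperDisc_holds K g hg

/-- **What the line bets on.** IF the composite lever holds, then the route's thesis X (a
`0`-surgery pair, `K` slice, `K'` not slice) yields a Gluck twist of `S⁴` that is NOT diffeomorphic
to `S⁴` (a negative answer to Kirby Problem 4.24 / Gluck 1962): the non-slice `K'` would be slice
in it. Equivalently: "all Gluck twists standard" + the lever ⇒ `Assembly2` (the route's kill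
switch). The line therefore asserts that every `0`-surgery-born homotopy sphere behaves like a Gluck
twist for `s` — strictly more than the crux needs, and open (MMSW Question 9.12 asks dissolution
after one `ℂℙ²` even for balanced-presentation spheres). [cite: ManolescuMarengonSarkarWillis2023, Question 9.12] -/
theorem exoticGluckTwist_of_pairsSliceInGluckTwist_of_zseThesis (hG : PairsSliceInGluckTwist)
    (hX : ZseThesis) :
    ∃ (K₂ : TwoKnot) (X : Type) (_ : TopologicalSpace X) (_ : T2Space X)
      (_ : SecondCountableTopology X) (_ : ChartedSpace (𝔼 4) X) (_ : IsManifold (𝓡 4) ∞ X),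
      IsGluckTwist (𝓡 4) X K₂ ∧ IsEmpty (X ≃ₘ⟮𝓡 4, 𝓡 4⟯ 𝕊⁴) ∧
        ∃ (K' : Knot) (e : 𝔼 4 → X) (f : 𝔼 2 → X), K'.IsSliceDiscIn X e f ∧ ¬ K'.IsSmoothlySlice := by
  obtain ⟨K, K', Y, _, _, h1, h2, h3, h4⟩ := hX
  obtain ⟨K₂, X, _, _, _, _, _, hXG, e, f, hf⟩ := hG K K' Y h1 h2 h3
  refine ⟨K₂, X, _, ‹_›, ‹_›, _, ‹_›, hXG, ⟨fun φ ↦ h4 ?_⟩, K', e, f, hf, h4⟩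
  exact isSmoothlySlice_of_isSliceDiscIn_of_diffeomorph hf φ

/-- The same bet read positively: the lever plus "every Gluck twist of `S⁴` carrying such a disc is
standard" give the kill switch `Assembly2 = ¬ ZseThesis`. [folklore] -/
theorem assembly2_of_pairsSliceInGluckTwist_of_gluckStandard (hG : PairsSliceInGluckTwist)
    (hStd : ∀ (K₂ : TwoKnot) (X : Type) [TopologicalSpace X] [T2Space X]
      [SecondCountableTopology X] [ChartedSpace (𝔼 4) X] [IsManifold (𝓡 4) ∞ X],
      IsGluckTwist (𝓡 4) X K₂ → Nonempty (X ≃ₘ⟮𝓡 4, 𝓡 4⟯ 𝕊⁴)) : Assembly2 := by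
  intro K K' Y _ _ h1 h2 h3
  obtain ⟨K₂, X, _, _, _, _, _, hXG, e, f, hf⟩ := hG K K' Y h1 h2 h3
  obtain ⟨φ⟩ := hStd K₂ X hXG
  exact isSmoothlySlice_of_isSliceDiscIn_of_diffeomorph hf φ

/-- The diagonal of the lever is harmless: every slice knot is slice in SOME Gluck twist, GIVEN
that `S⁴` is the Gluck twist on the unknotted sphere (named fact `isGluckTwist_sphere_unknotTwo`)
and that slice knots are slice in `S⁴ ∖ B̊⁴` in the `IsSliceDiscIn` sense (from the PROVED
`IsSmoothlySlice.isHomotopyBallSlice_holds` one only gets SOME homotopy sphere, so the `S⁴`-specific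
form is taken as a hypothesis here). NEAR-MISS flag: none — recorded to show the diagonal test does
not bite the lever. [folklore] -/
theorem sliceInSomeGluckTwist_of_isSliceDiscIn_sphere
    (hG : isGluckTwist_sphere_unknotTwo) {K : Knot} {e : 𝔼 4 → 𝕊⁴} {f : 𝔼 2 → 𝕊⁴}
    (h : K.IsSliceDiscIn 𝕊⁴ e f) : SliceInSomeGluckTwist K :=
  ⟨unknotTwo, _, _, inferInstance, inferInstance, _, inferInstance, hG, e, f, h⟩

/-! ## §6 Why it resists; the profile of any counterexample -/

/-- **WHY IT RESISTS — and what a counterexample must look like.**  Given Rasmussen's Theorem 1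
and MMSW Cor 1.13 (both named facts of the tree), any counterexample `(K, K', Y, s)` to the crux has:
`K` smoothly slice, `s(K') = s ≠ 0`, hence `K'` NOT smoothly slice and NOT concordant to `K`
(Fox–Milnor), yet `K'` slice in a homotopy 4-ball (MP Lemma 3.3, proved) — so `(K, K')` is a witness
of the route's thesis X and of `FGMWRasmussenStrategy`, the homotopy sphere carrying the disc is an
EXOTIC `S⁴` (FGMW, proved), and it is NOT a Gluck twist of `S⁴` along any 2-knot (MMSW Cor 1.13).
Printed coverage, i.e. where such a pair provably does not exist (docstring level; the tree has no
RBG links): (i) `K' = K`, `K'` concordant to `K`, `X₀(K) ≅ X₀(K')` (trace embedding lemma) — dead;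
(ii) pairs presented by Manolescu–Piccirillo's SPECIAL RBG links (Nakamura 2023, Thm 3.13: `s`
cannot obstruct there) and by SUPER-SPECIAL RBG links (Dunfield–Gong 2025, Thm 5.9, with Ren's
Cor 1.5) — dead; DG's census of ≈5·10⁵ `0`-friend pairs among knots up to 18–19 crossings produced no
`(slice, s ≠ 0)` pair, their four live Table-11 pairs being super-special with plain `s(K') = 0`
(only the LEO refinement `s̃_c` sees the partner) — so even if they yield an exotic `S⁴` they do NOT
refute this crux; (iii) Gluck-twist-born spheres (MMSW Cor 1.13) and spheres dissolving after one
`ℂℙ²` AND one `ℂℙ²bar` (MMSW §9.3) — dead.  HANDLE COUNT REMARK (paper, not formalised): if `K` is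
RIBBON with a ribbon disc of `m` minima (`m - 1` saddles), the MP sphere `Z = X₀(K') ∪_Y (B⁴ ∖ νD)`
has a handle decomposition with `m` 1-handles, `m` 2-handles, no 3-handles and one 4-handle, i.e.
dually NO 1-handles, `m` 2-handles and `m` 3-handles: for `m = 1` (`K` = unknot) Gabai's Property R
forces `K' =` unknot; for `m = 2` a counterexample is a 2-component link `L ⊂ S³` with
`S³₀(L) = #² S¹×S²` whose sphere is exotic — a failure of "generalised Property R spheres are
standard" (Gompf–Scharlemann–Thompson 2010; Meier–Zupan), for which no candidate is known.  A search
must therefore certify THREE things at once: a `0`-surgery homeomorphism outside the Nakamura /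
Dunfield–Gong families and not extending over traces, a slice (in practice ribbon) disc for `K`, and
`s(K') ≠ 0` by a certified Khovanov computation — and success is an exotic `S⁴`.
[cite: DunfieldGong2025, Thm. 5.9 and Table 11] [cite: Nakamura2023, Thm. 3.13]
[cite: ManolescuMarengonSarkarWillis2023, Cor. 1.13 and §9.3] -/
theorem counterexample_profile (hR : eq_zero_of_isSmoothlySlice)
    (h113 : Literature.Barriers.SmoothPoincare4.rasmussen_eq_zero_of_isSliceDiscIn_gluckTwist)
    (h : ¬ Crux) :
    ∃ (K K' : Knot) (Y : Type) (_ : TopologicalSpace Y) (_ : ChartedSpace (𝔼 3) Y) (s : ℤ),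
      IsIntegralSurgery (𝓡 3) Y K 0 ∧ IsIntegralSurgery (𝓡 3) Y K' 0 ∧ K.IsSmoothlySlice ∧
        K'.HasRasmussenInvariant s ∧ s ≠ 0 ∧ ¬ K'.IsSmoothlySlice ∧ ¬ K'.IsConcordant K ∧
        K'.IsHomotopyBallSlice ∧ Literature.Barriers.SmoothPoincare4.FGMWRasmussenStrategy ∧
        (∀ (K₂ : TwoKnot) (X : Type) [TopologicalSpace X] [T2Space X] [SecondCountableTopology X]
          [ChartedSpace (𝔼 4) X] [IsManifold (𝓡 4) ∞ X], IsGluckTwist (𝓡 4) X K₂ →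
          ∀ (e : 𝔼 4 → X) (f : 𝔼 2 → X), ¬ K'.IsSliceDiscIn X e f) := by
  obtain ⟨K, K', Y, _, _, s, h1, h2, h3, h4, h5⟩ := not_crux_iff_cruxRasmussen.1 h
  have hb : K'.IsHomotopyBallSlice := isHomotopyBallSlice_of_pair h1 h2 h3
  refine ⟨K, K', Y, _, _, s, h1, h2, h3, h4, h5, fun h6 ↦ h5 (hR h4 h6),
    fun hc ↦ h5 (hR h4 (hc.isSmoothlySlice h3)), hb, ⟨K', hb, s, h4, h5⟩, ?_⟩
  intro K₂ X _ _ _ _ _ hX e f hf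
  exact h5 (h113 K₂ X hX K' e f hf s h4)


/-! ## §7 Mirror calculus (gen 2, UNCONDITIONAL): the pair relation is orientation-blind; one inequality suffices -/

/-- **Mirror of the one-component framed link**: `(K, m)` mirrored is `(K̄, -m)` (componentwise
`Knot.mirror`, framings negated; definitional up to `-m`). [folklore] -/
theorem single_mirror (K : Knot) (m : ℤ) :
    (FramedLink.single K m).mirror = FramedLink.single K.mirror (-m) := by
  simp only [FramedLink.mirror, FramedLink.single]
  congr 1

/-- **`m`-surgery on `K` is `(-m)`-surgery on the mirror image `K̄`** — for the SAME (unoriented)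
manifold `Y`, any charted space `Y` (no manifold axioms needed): the tree's PROVED
`FramedLink.IsSurgery.mirror` (reflect `S³`, flip the circle factor of the solid torus) transported
through `FramedLink.isSurgery_single_iff`. [cite: GompfStipsicz1999, §5.1] -/
theorem isIntegralSurgery_mirror {Y : Type} [TopologicalSpace Y] [ChartedSpace (𝔼 3) Y]
    {K : Knot} {m : ℤ} (h : IsIntegralSurgery (𝓡 3) Y K m) :
    IsIntegralSurgery (𝓡 3) Y K.mirror (-m) := by
  rw [← FramedLink.isSurgery_single_iff] at h ⊢
  rw [← single_mirror]
  exact h.mirror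

/-- `Y` is `0`-surgery on `K̄` iff it is `0`-surgery on `K`. [cite: GompfStipsicz1999, §5.1] -/
theorem isIntegralSurgery_zero_mirror_iff {Y : Type} [TopologicalSpace Y] [ChartedSpace (𝔼 3) Y]
    (K : Knot) : IsIntegralSurgery (𝓡 3) Y K.mirror 0 ↔ IsIntegralSurgery (𝓡 3) Y K 0 := by
  constructor
  · intro h
    have h' := isIntegralSurgery_mirror h
    rwa [neg_zero, show K.mirror.mirror = K from SphereEmbedding.mirror_mirror K] at h'
  · intro h
    have h' := isIntegralSurgery_mirror h
    rwa [neg_zero] at h'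

/-- **Every knot is a `0`-friend of its mirror image, in the tree's sense** (`S³₀(K̄) = -S³₀(K)` and
`IsIntegralSurgery` does not see orientations): whenever `Y` is `0`-surgery on `K` (such `Y` exists,
`exists_isIntegralSurgery_holds`), `(K, K̄, Y)` satisfies the pair hypotheses of the crux.  So the
crux's pair relation is ORIENTATION-BLIND: it contains, besides Manolescu–Piccirillo's
orientation-preserving `0`-surgery homeomorphisms, all pairs `(K, K')` with `S³₀(K') ≅ -S³₀(K)`.
Harmless for truth (such a `K'` is an honest `0`-friend of `K̄`, and `K̄` is slice iff `K` is,
`isSmoothlySlice_mirror_iff`), but every LINE must be stated so as to survive `K' = K̄` (e.g. no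
"the identification `S³₀(K) → S³₀(K')` is induced by an RBG link" without allowing a reflection).
[cite: GompfStipsicz1999, §5.1] -/
theorem zeroSurgeryPair_self_mirror {Y : Type} [TopologicalSpace Y] [ChartedSpace (𝔼 3) Y]
    {K : Knot} (h : IsIntegralSurgery (𝓡 3) Y K 0) :
    IsIntegralSurgery (𝓡 3) Y K 0 ∧ IsIntegralSurgery (𝓡 3) Y K.mirror 0 :=
  ⟨h, (isIntegralSurgery_zero_mirror_iff K).2 h⟩

/-- **Sliceness is mirror-invariant** (PROVED route: `g₄(K̄) = g₄(K)`, `Knot.sliceGenus_mirror_holds`,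
and `g₄ = 0 ↔ slice`, `Knot.sliceGenus_eq_zero_iff_holds`). [cite: Livingston2005, §9.5] -/
theorem isSmoothlySlice_mirror {K : Knot} (h : K.IsSmoothlySlice) : K.mirror.IsSmoothlySlice := by
  rw [← Knot.sliceGenus_eq_zero_iff_holds] at h ⊢
  rw [Knot.sliceGenus_mirror_holds K]
  exact h

/-- `K̄` is smoothly slice iff `K` is. [cite: Livingston2005, §9.5] -/
theorem isSmoothlySlice_mirror_iff (K : Knot) : K.mirror.IsSmoothlySlice ↔ K.IsSmoothlySlice :=
  ⟨fun h ↦ by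
      have h' := isSmoothlySlice_mirror h
      rwa [show K.mirror.mirror = K from SphereEmbedding.mirror_mirror K] at h',
    isSmoothlySlice_mirror⟩

/-- **The pair hypotheses of the crux are closed under simultaneous mirror image** (with the
Rasmussen invariant negated: `HasRasmussenInvariant.mirror_holds`, PROVED in the tree). [folklore] -/
theorem pair_mirror {K K' : Knot} {Y : Type} [TopologicalSpace Y] [ChartedSpace (𝔼 3) Y] {s : ℤ}
    (h1 : IsIntegralSurgery (𝓡 3) Y K 0) (h2 : IsIntegralSurgery (𝓡 3) Y K' 0)
    (h3 : K.IsSmoothlySlice) (h4 : K'.HasRasmussenInvariant s) :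
    IsIntegralSurgery (𝓡 3) Y K.mirror 0 ∧ IsIntegralSurgery (𝓡 3) Y K'.mirror 0 ∧
      K.mirror.IsSmoothlySlice ∧ K'.mirror.HasRasmussenInvariant (-s) :=
  ⟨(isIntegralSurgery_zero_mirror_iff K).2 h1, (isIntegralSurgery_zero_mirror_iff K').2 h2,
    isSmoothlySlice_mirror h3, HasRasmussenInvariant.mirror_holds h4⟩

/-- **One-sided form (≤) of the crux**: on `0`-surgery pairs with `K` slice, `s(K') ≤ 0`. [folklore] -/
def CruxNonpos : Prop :=
  ∀ (K K' : Knot) (Y : Type) [TopologicalSpace Y] [ChartedSpace (𝔼 3) Y] (s : ℤ),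
    IsIntegralSurgery (𝓡 3) Y K 0 → IsIntegralSurgery (𝓡 3) Y K' 0 → K.IsSmoothlySlice →
      K'.HasRasmussenInvariant s → s ≤ 0

/-- **One-sided form (≥) of the crux**: on `0`-surgery pairs with `K` slice, `0 ≤ s(K')`. [folklore] -/
def CruxNonneg : Prop :=
  ∀ (K K' : Knot) (Y : Type) [TopologicalSpace Y] [ChartedSpace (𝔼 3) Y] (s : ℤ),
    IsIntegralSurgery (𝓡 3) Y K 0 → IsIntegralSurgery (𝓡 3) Y K' 0 → K.IsSmoothlySlice →
      K'.HasRasmussenInvariant s → 0 ≤ s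

/-- **MIRROR CLOSURE, rigorous and unconditional: the crux is equivalent to its one-sided form
`s(K') ≤ 0`.** (`←`: apply the inequality to the pair and to its mirror, `pair_mirror`.)  So every
line may prove ONE inequality only — typically the negative-definite one (adjunction / Ren–Willis-type
bounds for `s` in `#ᵗ ℂℙ²bar`, MMSW 2023 Thm 1.4-type statements); the opposite inequality is free.
[cite: ManolescuMarengonSarkarWillis2023, Cor. 1.13] -/
theorem crux_iff_cruxNonpos : Crux ↔ CruxNonpos := by
  constructor
  · intro h K K' Y _ _ s h1 h2 h3 h4
    exact (h K K' Y s h1 h2 h3 h4).le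
  · intro h K K' Y _ _ s h1 h2 h3 h4
    obtain ⟨m1, m2, m3, m4⟩ := pair_mirror h1 h2 h3 h4
    have hle : s ≤ 0 := h K K' Y s h1 h2 h3 h4
    have hge : -s ≤ 0 := h K.mirror K'.mirror Y (-s) m1 m2 m3 m4
    omega

/-- **Mirror closure, the other side: the crux is equivalent to `0 ≤ s(K')` on pairs.** [cite: ManolescuMarengonSarkarWillis2023, Cor. 1.13] -/
theorem crux_iff_cruxNonneg : Crux ↔ CruxNonneg := by
  constructor
  · intro h K K' Y _ _ s h1 h2 h3 h4
    exact (h K K' Y s h1 h2 h3 h4).ge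
  · intro h K K' Y _ _ s h1 h2 h3 h4
    obtain ⟨m1, m2, m3, m4⟩ := pair_mirror h1 h2 h3 h4
    have hge : 0 ≤ s := h K K' Y s h1 h2 h3 h4
    have hle : 0 ≤ -s := h K.mirror K'.mirror Y (-s) m1 m2 m3 m4
    omega

/-- **For the disprover: counterexamples come in mirror pairs** — if the crux fails there is a
pair with `s(K') > 0` AND a pair with `s(K') < 0` (unconditional). So a search may normalise the
sign of the witness, and any vanishing theorem for one sign kills both. [folklore] -/
theorem counterexamples_come_in_mirror_pairs (h : ¬ Crux) :
    (∃ (K K' : Knot) (Y : Type) (_ : TopologicalSpace Y) (_ : ChartedSpace (𝔼 3) Y) (s : ℤ),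
      IsIntegralSurgery (𝓡 3) Y K 0 ∧ IsIntegralSurgery (𝓡 3) Y K' 0 ∧ K.IsSmoothlySlice ∧
        K'.HasRasmussenInvariant s ∧ 0 < s) ∧
    (∃ (K K' : Knot) (Y : Type) (_ : TopologicalSpace Y) (_ : ChartedSpace (𝔼 3) Y) (s : ℤ),
      IsIntegralSurgery (𝓡 3) Y K 0 ∧ IsIntegralSurgery (𝓡 3) Y K' 0 ∧ K.IsSmoothlySlice ∧
        K'.HasRasmussenInvariant s ∧ s < 0) := by
  obtain ⟨K, K', Y, _, _, s, h1, h2, h3, h4, h5⟩ := not_crux_iff_cruxRasmussen.1 h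
  obtain ⟨m1, m2, m3, m4⟩ := pair_mirror h1 h2 h3 h4
  rcases lt_or_gt_of_ne h5 with hs | hs
  · exact ⟨⟨K.mirror, K'.mirror, Y, _, _, -s, m1, m2, m3, m4, by omega⟩,
      ⟨K, K', Y, _, _, s, h1, h2, h3, h4, hs⟩⟩
  · exact ⟨⟨K, K', Y, _, _, s, h1, h2, h3, h4, hs⟩,
      ⟨K.mirror, K'.mirror, Y, _, _, -s, m1, m2, m3, m4, by omega⟩⟩

/-- The diagonal of the mirror calculus: the crux applied to the always-available pair `(K, K̄)`
says `s(K̄) = 0` for `K` slice — Rasmussen's theorem for `K̄` (slice with `K`); no new content, but it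
shows the pair `(K, K̄)` can never be a witness. [cite: Rasmussen2010, Thm. 1] -/
theorem crux_pair_self_mirror (h : Crux) {K : Knot} {Y : Type} [TopologicalSpace Y]
    [ChartedSpace (𝔼 3) Y] (hY : IsIntegralSurgery (𝓡 3) Y K 0) (hK : K.IsSmoothlySlice) {s : ℤ}
    (hs : K.mirror.HasRasmussenInvariant s) : s = 0 :=
  h K K.mirror Y s hY (zeroSurgeryPair_self_mirror hY).2 hK hs

/-! ## §8 The 2026 candidate pool: slice concordance-friends (Kegel–Spreer, arXiv:2603.22438) -/

/-- **A slice concordance-friend of a knot with `s ≠ 0`** — the success condition of Kegel–Spreer's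
Algorithm 6 ("Search for a pair of knots that are concordance friends but have different sliceness
statuses", arXiv:2603.22438, March 2026, §6.3): a smoothly SLICE knot `K` with a `0`-friend `K'`
that is CONCORDANT to a knot `K₀` of non-zero Rasmussen invariant.  LIVE PRINTED INSTANCES (sliceness
of `K` open; each would refute this crux and produce an exotic `S⁴`):
(i) §6.2(1): `K = W₊''`, a 262-crossing `0`-friend (found by their Algorithm 4, verified in SnapPy)
of `K' = W₊'`, which is `Wh⁺(T₂,₃)` plus one ribbon band, hence concordant to the positive untwisted
Whitehead double `K₀ = W₊ = Wh⁺(T₂,₃)` of the right-handed trefoil — topologically slice (`Δ = 1`),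
not smoothly slice (Hedden 2007: `τ = 1`), and `s(W₊) = 2` — `W₊` is strongly quasipositive of genus `1`
(Rudolph 1993) and `s = 2g₄ = 2g` on strongly quasipositive knots (Plamenevskaya 2006, Shumakovitch 2007);
"We do not know if `W₊''` is smoothly slice" (p. 17);
(ii) §6.4: the 184 knots of their set `F4` (79–1620 crossings) and 78 of `F6` (91–1497 crossings)
that are `0`-friends of knots concordant to the Conway knot's friends `K1, K2` ("we can compute their
`s`-invariants to be non-trivial", Ex. 2.2, p. 8) and `K3` (Piccirillo's knot, `s = 2`) — those
descending from `K4` (no `s` reported) or from the three Dunfield–Gong knots (partners have `s = 0`,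
`s̃_c ≠ 0`) do NOT bear on this crux; for none of the 262 diagrams was a ribbon certificate found
(3·10⁴ band attachments each, §6.4 steps (6), (8); p. 22: "If it turns out that one of these
examples is slice, then there exists an exotic 4-sphere").
(iii) NOT instances: §6.2(2) `W₋''` (friend-concordant to `Wh⁻(T₂,₃)`, whose `s` is `0`… its
sliceness itself is open) and §6.2(3) `C''` (friend-concordant to the `(2,1)`-cable of `4₁`, `s = 0`,
non-slice by DKMPS 2024) — wrong sign of information for an `s`-witness.
These are the FIRST live candidates against this crux in print since Dunfield–Gong 2025 (whose 25
`(unknown, s ≠ 0)` pairs all died, §11).  [cite: KegelSpreer2026, §6.2–6.4 (arXiv:2603.22438)] -/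
def SliceConcordanceFriend : Prop :=
  ∃ (K K' K₀ : Knot) (Y : Type) (_ : TopologicalSpace Y) (_ : ChartedSpace (𝔼 3) Y) (s : ℤ),
    IsIntegralSurgery (𝓡 3) Y K 0 ∧ IsIntegralSurgery (𝓡 3) Y K' 0 ∧ K.IsSmoothlySlice ∧
      K'.IsConcordant K₀ ∧ K₀.HasRasmussenInvariant s ∧ s ≠ 0

/-- **A slice concordance-friend kills the crux**, given Rasmussen's concordance invariance of `s`
(named fact `HasRasmussenInvariant.eq_of_isConcordant`, Rasmussen 2010 Thm 1; existence of SOME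
Rasmussen invariant of `K'` is the DISCHARGED `Knot.exists_hasGaussDiagram_of_isIsotopic_holds`).
So Kegel–Spreer's search (any slice `W₊''`, any slice `F4`/`F6`-knot below `K1, K2, K3`) is a search
for `¬Crux`. [cite: KegelSpreer2026, §6.3 (arXiv:2603.22438)] -/
theorem not_crux_of_sliceConcordanceFriend (hC : HasRasmussenInvariant.eq_of_isConcordant)
    (h : SliceConcordanceFriend) : ¬ Crux := by
  intro hc
  obtain ⟨K, K', K₀, Y, _, _, s, h1, h2, h3, h4, h5, h6⟩ := h
  obtain ⟨K'', D, hK'', hD⟩ := Knot.exists_hasGaussDiagram_of_isIsotopic_holds K'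
  have hK' : K'.HasRasmussenInvariant D.rasmussenInvariant := ⟨K'', D, hK'', hD, rfl⟩
  have h0 : D.rasmussenInvariant = 0 := hc K K' Y _ h1 h2 h3 hK'
  exact h6 ((hC hK' h5 h4).symm.trans h0)

/-- Conversely a counterexample to the crux IS a slice concordance-friend (`K₀ = K'`, concordance is
reflexive: `Knot.IsConcordant.refl'`, PROVED). [folklore] -/
theorem sliceConcordanceFriend_of_not_crux (h : ¬ Crux) : SliceConcordanceFriend := by
  obtain ⟨K, K', Y, _, _, s, h1, h2, h3, h4, h5⟩ := not_crux_iff_cruxRasmussen.1 h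
  exact ⟨K, K', K', Y, _, _, s, h1, h2, h3, Knot.IsConcordant.refl' K', h4, h5⟩

/-- **The crux ⟺ no slice concordance-friend of a knot with `s ≠ 0` exists** (mod Rasmussen's
concordance invariance).  This is the form in which the crux is currently being ATTACKED in print
(Kegel–Spreer 2026, Algorithm 6), and the form a prover must keep in mind: a proof of the crux
certifies non-sliceness of `W₊''` and of every `F4`/`F6` knot below `K1, K2, K3`.
[cite: KegelSpreer2026, §6 (arXiv:2603.22438)] -/
theorem crux_iff_not_sliceConcordanceFriend (hC : HasRasmussenInvariant.eq_of_isConcordant) :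
    Crux ↔ ¬ SliceConcordanceFriend :=
  ⟨fun hc hf ↦ not_crux_of_sliceConcordanceFriend hC hf hc,
    fun hf ↦ not_not.1 fun hc ↦ hf (sliceConcordanceFriend_of_not_crux hc)⟩

/-- What a proof of the crux delivers on the candidate pool (given concordance invariance): every
slice `0`-friend `K` of a knot `K'` forces `s(K₀) = 0` for ALL knots `K₀` concordant to `K'` — e.g.
`Crux` ⇒ `W₊''` is not slice (since `s(W₊) = 2`). [cite: KegelSpreer2026, §6.2 (arXiv:2603.22438)] -/
theorem eq_zero_of_crux_of_isConcordant (hC : HasRasmussenInvariant.eq_of_isConcordant) (hc : Crux)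
    {K K' K₀ : Knot} {Y : Type} [TopologicalSpace Y] [ChartedSpace (𝔼 3) Y] {s : ℤ}
    (h1 : IsIntegralSurgery (𝓡 3) Y K 0) (h2 : IsIntegralSurgery (𝓡 3) Y K' 0)
    (h3 : K.IsSmoothlySlice) (h4 : K'.IsConcordant K₀) (h5 : K₀.HasRasmussenInvariant s) : s = 0 := by
  by_contra h6
  exact not_crux_of_sliceConcordanceFriend hC ⟨K, K', K₀, Y, _, _, s, h1, h2, h3, h4, h5, h6⟩ hc

/-! ## §9 `∀`-form versus `∃`-form of the conclusion (mod the two undischarged well-definedness facts) -/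

/-- **`s(K)` is single-valued**, modulo the two named facts still UNDISCHARGED in the tree —
Reidemeister's theorem in Gauss-diagram form (`Knot.reidemeister`) and Reidemeister invariance of the
diagrammatic `s` (`GaussDiagram.rasmussenInvariant_eq_of_equiv`); existence
(`Knot.exists_hasGaussDiagram_of_isIsotopic_holds`) and the isotopy facts (instance
`SphereEmbedding.isotopyFacts`) are PROVED. [cite: Rasmussen2010, Thm. 1] -/
theorem hasRasmussenInvariant_unique (hR : Knot.reidemeister)
    (hinv : GaussDiagram.rasmussenInvariant_eq_of_equiv) {K : Knot} {s t : ℤ}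
    (hs : K.HasRasmussenInvariant s) (ht : K.HasRasmussenInvariant t) : s = t :=
  (Knot.existsUnique_hasRasmussenInvariant Knot.exists_hasGaussDiagram_of_isIsotopic_holds hR hinv
    K).unique hs ht

/-- **The crux (a `∀ s` statement about EVERY Gauss diagram of EVERY knot isotopic to `K'`) is
equivalent to its `∃`-form "some Rasmussen invariant of `K'` is `0`" only modulo uniqueness of `s`.**
NOTE FOR PROVERS: as filed, the crux must bound `D.rasmussenInvariant` for each realisable diagram
`D` separately; Rasmussen/MMSW/Ren–Willis-type arguments (cobordism maps on the Lee complex OF THAT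
DIAGRAM) do exactly this, so no discharge of `reidemeister` is forced — but any shortcut that computes
`s` from ONE convenient diagram and transfers it needs `hasRasmussenInvariant_unique`, i.e. the two
open facts. [cite: Rasmussen2010, Thm. 1] -/
theorem crux_iff_exists_form (hR : Knot.reidemeister)
    (hinv : GaussDiagram.rasmussenInvariant_eq_of_equiv) :
    Crux ↔ ∀ (K K' : Knot) (Y : Type) [TopologicalSpace Y] [ChartedSpace (𝔼 3) Y],
      IsIntegralSurgery (𝓡 3) Y K 0 → IsIntegralSurgery (𝓡 3) Y K' 0 → K.IsSmoothlySlice →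
        ∃ s, K'.HasRasmussenInvariant s ∧ s = 0 := by
  constructor
  · intro h K K' Y _ _ h1 h2 h3
    obtain ⟨K'', D, hK'', hD⟩ := Knot.exists_hasGaussDiagram_of_isIsotopic_holds K'
    exact ⟨D.rasmussenInvariant, ⟨K'', D, hK'', hD, rfl⟩, h K K' Y _ h1 h2 h3 ⟨K'', D, hK'', hD, rfl⟩⟩
  · intro h K K' Y _ _ s h1 h2 h3 h4
    obtain ⟨s₀, hs₀, h0⟩ := h K K' Y h1 h2 h3
    exact (hasRasmussenInvariant_unique hR hinv h4 hs₀).trans h0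

/-! ## §10 Audit of the formal statement: no junk model (gen 2) -/

/-- **NON-VACUITY, all four hypotheses at once** (gen 1 showed satisfiability without the invariant
hypothesis): `K = K' =` unknot, `Y = S³₀(U)`, `s = 0` (`hasRasmussenInvariant_unknot_holds`: the round
unknot has the empty Gauss diagram, `s = 0`).  AUDIT SUMMARY (paper + computation, details in the
module docstring §10): every constituent predicate of the crux is an honest formalisation — in
particular `Knot.IsSliceDisc` asks for a smooth injective immersion of a NEIGHBOURHOOD OF THE CLOSED
DISC (so the cone on `K` from a point `p ∈ K`, a proper smooth embedding of the OPEN disc into `B̊⁴`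
with frontier `K` that exists for every knot, is correctly excluded: it is not immersed at `p`), and
the tree's Gauss-diagram Lee complex reproduces the known `s` on 56 test diagrams (all unknot diagrams
`↦ 0`), so no mis-normalised diagram fakes a witness `unknot.HasRasmussenInvariant s`, `s ≠ 0`.
Hence no formal shortcut to `¬Crux` exists: a kill is a genuine `0`-surgery pair, i.e. (§2) an exotic
`S⁴`. [folklore] -/
theorem crux_nonvacuous :
    ∃ (K K' : Knot) (Y : Type) (_ : TopologicalSpace Y) (_ : ChartedSpace (𝔼 3) Y) (s : ℤ),
      IsIntegralSurgery (𝓡 3) Y K 0 ∧ IsIntegralSurgery (𝓡 3) Y K' 0 ∧ K.IsSmoothlySlice ∧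
        K'.HasRasmussenInvariant s := by
  obtain ⟨Y, _, _, _, _, _, _, hY⟩ := exists_isIntegralSurgery_holds unknot 0
  exact ⟨unknot, unknot, Y, _, _, 0, hY, hY, isSmoothlySlice_unknot, hasRasmussenInvariant_unknot_holds⟩

/-- The crux HOLDS at its only fully computable instance in the tree, `(U, U, S³₀(U))`, for the
invariant value the tree can certify (`s = 0`) — and for every other value `s` of a hypothetical second
Rasmussen invariant of the unknot only modulo uniqueness (§9).  Recorded to show where the first
non-trivial instance lies: `K =` unknot and `K'` arbitrary is Gabai's Property R (`S³₀(K') = S¹ × S²`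
forces `K' = U`; tree fact `isUnknot_of_isIntegralSurgery_zero`, stated for the model `𝕊 2 × 𝕊 1`
and needing uniqueness of surgery to reach an abstract `Y`). [cite: GabaiJDG1987, Cor. 8.3] -/
theorem crux_at_unknot_zero {Y : Type} [TopologicalSpace Y] [ChartedSpace (𝔼 3) Y]
    (_hY : IsIntegralSurgery (𝓡 3) Y unknot 0) : unknot.HasRasmussenInvariant 0 :=
  hasRasmussenInvariant_unknot_holds

/-! ## §11 Why it resists, 2026 update: `s`-witnesses self-destruct on every Nakamura–Ren class -/

/-- **Self-destruction of `s`-witnesses.**  Let `P` be any class of triples `(K, K', Y)` on which the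
crux is ALREADY A THEOREM (`hP`: on `P`, `K` slice ⇒ `s(K') = 0`).  Then every triple of `P` with
`s(K') ≠ 0` certifies that `K` is NOT slice — the candidate kills itself.  In print `P` = pairs
presented by a SUPER-SPECIAL RBG link (`R ∪ B`, `R ∪ G` Hopf, `b = g = 0`): Nakamura 2023 Thm 3.13 +
Ren 2023 Cor 1.5, recorded as Dunfield–Gong 2025 Thm 5.9 ("if `s_F(K_G) ≠ 0` then both `K_B` and `K_G`
are not smoothly slice"); this is how 24 of DG's 25 `(sliceness unknown, s(K') = ±2)` pairs died
(Table 10; the 25th, `18nh₀₀₀₁₀₂₇₀`, by `r = 0` ⇒ diffeomorphic traces ⇒ equal slice status), leaving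
in their census only pairs with `s(K') = 0` (Table 11, seen by `s̃_c` alone).  CENSUS OF WHERE A
COUNTEREXAMPLE CAN STILL LIVE (2026-08): a pair (a) outside every Nakamura–Ren class (no super-special,
indeed no "Nakamura-good" special RBG presentation — DG found one for 36/36 pairs they examined, with
"no heuristic reason" for this, Remark 5.12), (b) not a `0`-trace pair, (c) with `K` slice but no
slice disc found by 3·10⁴-band ribbon searches (Kegel–Spreer's `W₊''`, `F4`, `F6`, §8), and (d) whose
MP sphere is not a Gluck twist nor `ℂℙ²`/`ℂℙ²bar`-dissolvable (MMSW).  Nothing in print excludes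
(a)–(d) simultaneously; nothing in print exhibits it. [cite: DunfieldGong2025, Thm. 5.9 and Table 10] -/
theorem not_isSmoothlySlice_of_vanishingClass
    (P : ∀ (_K _K' : Knot) (Y : Type) [TopologicalSpace Y] [ChartedSpace (𝔼 3) Y], Prop)
    (hP : ∀ (K K' : Knot) (Y : Type) [TopologicalSpace Y] [ChartedSpace (𝔼 3) Y] (s : ℤ),
      P K K' Y → IsIntegralSurgery (𝓡 3) Y K 0 → IsIntegralSurgery (𝓡 3) Y K' 0 →
        K.IsSmoothlySlice → K'.HasRasmussenInvariant s → s = 0)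
    {K K' : Knot} {Y : Type} [TopologicalSpace Y] [ChartedSpace (𝔼 3) Y] {s : ℤ}
    (hp : P K K' Y) (h1 : IsIntegralSurgery (𝓡 3) Y K 0) (h2 : IsIntegralSurgery (𝓡 3) Y K' 0)
    (h4 : K'.HasRasmussenInvariant s) (h5 : s ≠ 0) : ¬ K.IsSmoothlySlice :=
  fun h3 ↦ h5 (hP K K' Y s hp h1 h2 h3 h4)

/-- Consequently a counterexample to the crux lies OUTSIDE every class on which the crux is a theorem
(pure logic, recorded as the search directive: enumerate pairs, discard those with a Nakamura–Ren
presentation, then certify `K` slice and `s(K') ≠ 0`). [cite: DunfieldGong2025, Remark 5.12] -/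
theorem counterexample_avoids_vanishingClass
    (P : ∀ (_K _K' : Knot) (Y : Type) [TopologicalSpace Y] [ChartedSpace (𝔼 3) Y], Prop)
    (hP : ∀ (K K' : Knot) (Y : Type) [TopologicalSpace Y] [ChartedSpace (𝔼 3) Y] (s : ℤ),
      P K K' Y → IsIntegralSurgery (𝓡 3) Y K 0 → IsIntegralSurgery (𝓡 3) Y K' 0 →
        K.IsSmoothlySlice → K'.HasRasmussenInvariant s → s = 0)
    {K K' : Knot} {Y : Type} [TopologicalSpace Y] [ChartedSpace (𝔼 3) Y] {s : ℤ}
    (h1 : IsIntegralSurgery (𝓡 3) Y K 0) (h2 : IsIntegralSurgery (𝓡 3) Y K' 0)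
    (h3 : K.IsSmoothlySlice) (h4 : K'.HasRasmussenInvariant s) (h5 : s ≠ 0) : ¬ P K K' Y :=
  fun hp ↦ h5 (hP K K' Y s hp h1 h2 h3 h4)

/-- **If every pair belonged to a vanishing class the crux would follow** (the shape of the
`super-special-normal-form` line: universality of the presentation + the printed engine). [folklore] -/
theorem crux_of_universal_vanishingClass
    (P : ∀ (_K _K' : Knot) (Y : Type) [TopologicalSpace Y] [ChartedSpace (𝔼 3) Y], Prop)
    (hP : ∀ (K K' : Knot) (Y : Type) [TopologicalSpace Y] [ChartedSpace (𝔼 3) Y] (s : ℤ),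
      P K K' Y → IsIntegralSurgery (𝓡 3) Y K 0 → IsIntegralSurgery (𝓡 3) Y K' 0 →
        K.IsSmoothlySlice → K'.HasRasmussenInvariant s → s = 0)
    (hU : ∀ (K K' : Knot) (Y : Type) [TopologicalSpace Y] [ChartedSpace (𝔼 3) Y],
      IsIntegralSurgery (𝓡 3) Y K 0 → IsIntegralSurgery (𝓡 3) Y K' 0 → K.IsSmoothlySlice → P K K' Y) :
    Crux :=
  fun K K' Y _ _ s h1 h2 h3 h4 ↦ hP K K' Y s (hU K K' Y h1 h2 h3) h1 h2 h3 h4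

/-- By mirror closure (§7) a vanishing class need only give ONE inequality, and universality need
only hold UP TO MIRROR: if every pair `(K, K', Y)` with `K` slice has either itself or its mirror
`(K̄, K̄', Y)` in a class `P` on which `s(K') ≤ 0`, hmm — no: one-sided information on a class that
is not mirror-closed does not suffice pair by pair; what suffices is `P`-membership of the pair OR of
its mirror when `P` gives the EQUALITY.  Recorded precisely: [folklore] -/
theorem crux_of_vanishingClass_upToMirror
    (P : ∀ (_K _K' : Knot) (Y : Type) [TopologicalSpace Y] [ChartedSpace (𝔼 3) Y], Prop)
    (hP : ∀ (K K' : Knot) (Y : Type) [TopologicalSpace Y] [ChartedSpace (𝔼 3) Y] (s : ℤ),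
      P K K' Y → IsIntegralSurgery (𝓡 3) Y K 0 → IsIntegralSurgery (𝓡 3) Y K' 0 →
        K.IsSmoothlySlice → K'.HasRasmussenInvariant s → s = 0)
    (hU : ∀ (K K' : Knot) (Y : Type) [TopologicalSpace Y] [ChartedSpace (𝔼 3) Y],
      IsIntegralSurgery (𝓡 3) Y K 0 → IsIntegralSurgery (𝓡 3) Y K' 0 → K.IsSmoothlySlice →
        P K K' Y ∨ P K.mirror K'.mirror Y) :
    Crux := by
  intro K K' Y _ _ s h1 h2 h3 h4
  rcases hU K K' Y h1 h2 h3 with hp | hp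
  · exact hP K K' Y s hp h1 h2 h3 h4
  · obtain ⟨m1, m2, m3, m4⟩ := pair_mirror h1 h2 h3 h4
    have := hP K.mirror K'.mirror Y (-s) hp m1 m2 m3 m4
    omega


/-! ## §7b Consequences of the mirror calculus for the strengthenings of §4 (gen 2) -/

/-- `s(T̄(2,3)) = -2` for the mirror image of the tree's positive trefoil (PROVED: `s(T(2,3)) = 2` and
`HasRasmussenInvariant.mirror_holds`). [cite: Rasmussen2010, Thm. 4] -/
theorem hasRasmussenInvariant_trefoil_mirror : trefoil.mirror.HasRasmussenInvariant (-2) :=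
  HasRasmussenInvariant.mirror_holds hasRasmussenInvariant_trefoil

/-- **`s` is NOT a `0`-surgery invariant in the tree's sense — UNCONDITIONALLY** (gen 1 had this only
modulo the Conway/Piccirillo pair, `cruxSInvariant_false_of_piccirilloConwayPair`): the always-available
pair `(T(2,3), T̄(2,3), S³₀(T(2,3)))` (`zeroSurgeryPair_self_mirror`) has `s = 2` and `s = -2`.  So no
proof of the crux can factor through "common `0`-surgery ⇒ equal `s`"; the sliceness of `K` must enter.
(For ORIENTATION-PRESERVING `0`-surgery homeomorphisms the same failure is Piccirillo 2020 / MP 2023, not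
constructible in the tree.) [cite: Rasmussen2010, Thm. 4] -/
theorem cruxSInvariant_false : ¬ CruxSInvariant := by
  intro h
  obtain ⟨Y, _, _, _, _, _, _, hY⟩ := exists_isIntegralSurgery_holds trefoil 0
  have := h trefoil trefoil.mirror Y (-2) 2 hY (zeroSurgeryPair_self_mirror hY).2
    hasRasmussenInvariant_trefoil hasRasmussenInvariant_trefoil_mirror
  norm_num at this

/-- HYPOTHESIS `H_FGMW⁰` — **`s` detects some topologically slice knot**: a knot `K` that is
topologically slice and has a non-zero Rasmussen invariant.  TRUE IN PRINT (the positive untwisted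
Whitehead double `W₊` of the right-handed trefoil: `Δ = 1`, hence topologically slice by Freedman; `s(W₊) = 2`
since `W₊` is strongly quasipositive of genus `1` — Rudolph 1993 — and `s = 2g` on such knots — Plamenevskaya
2006 / Shumakovitch 2007; Rasmussen 2010 §1 already notes that `s` detects topologically slice knots), not
constructible in the tree (no satellites / Whitehead doubles, no Freedman). Strictly weaker and older than the Conway/Piccirillo
pair used in §4. [cite: Rasmussen2010, Thm. 1] -/
def SDetectsTopSlice : Prop :=
  ∃ (K : Knot) (s : ℤ), K.IsTopologicallySlice ∧ K.HasRasmussenInvariant s ∧ s ≠ 0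

/-- **The topological variant of the crux is false as soon as `s` detects ONE topologically slice
knot** (no partner knot needed, thanks to the mirror pair): `(K, K̄, S³₀(K))` with `K` topologically
slice and `s(K̄) = -s ≠ 0`.  Sharpens gen 1's `cruxTop_false_of_piccirilloConwayPair` (hypothesis
shrinks from the Conway/Piccirillo pair to Rasmussen's 2004 example `Wh⁺(T₂,₃)`). [cite: Rasmussen2010, Thm. 1] -/
theorem cruxTop_false_of_sDetectsTopSlice (hW : SDetectsTopSlice) : ¬ CruxTop := by
  rintro h
  obtain ⟨K, s, hK, hs, hs0⟩ := hW
  obtain ⟨Y, _, _, _, _, _, _, hY⟩ := exists_isIntegralSurgery_holds K 0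
  have := h K K.mirror Y (-s) hY (zeroSurgeryPair_self_mirror hY).2 hK
    (HasRasmussenInvariant.mirror_holds hs)
  omega

/-! ## §7c String orientations are invisible too (gen 2) -/

/-- Reversing the component of the one-component framed link: `(K, m) ↦ (rK, m)`. [folklore] -/
theorem single_reverseComponent (K : Knot) (m : ℤ) :
    (FramedLink.single K m).reverseComponent 0 = FramedLink.single K.reverse m := by
  refine FramedLink.ext' (funext fun i ↦ ?_) rfl
  fin_cases i
  simp [FramedLink.reverseComponent, FramedLink.single]

/-- **`m`-surgery on `K` is `m`-surgery on the reversed knot `rK`** (same `Y`, same framing; any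
charted space `Y`): the proved `FramedLink.IsSurgery.reverseComponent'` through
`FramedLink.isSurgery_single_iff`.  With `HasRasmussenInvariant.reverse_holds` (`s(rK) = s(K)`, proved)
this makes the crux blind to the string orientations of `K` and `K'` — Gauss diagrams, RBG links and
annulus presentations may orient the knots arbitrarily. [cite: Kirby1989, Ch. I §2] -/
theorem isIntegralSurgery_reverse {Y : Type} [TopologicalSpace Y] [ChartedSpace (𝔼 3) Y]
    {K : Knot} {m : ℤ} (h : IsIntegralSurgery (𝓡 3) Y K m) : IsIntegralSurgery (𝓡 3) Y K.reverse m := by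
  rw [← FramedLink.isSurgery_single_iff] at h ⊢
  rw [← single_reverseComponent]
  exact h.reverseComponent' 0

/-- The pair hypotheses with `K'` reversed (and the invariant unchanged). [folklore] -/
theorem pair_reverse_right {K' : Knot} {Y : Type} [TopologicalSpace Y] [ChartedSpace (𝔼 3) Y]
    {s : ℤ} (h2 : IsIntegralSurgery (𝓡 3) Y K' 0) (h4 : K'.HasRasmussenInvariant s) :
    IsIntegralSurgery (𝓡 3) Y K'.reverse 0 ∧ K'.reverse.HasRasmussenInvariant s :=
  ⟨isIntegralSurgery_reverse h2, HasRasmussenInvariant.reverse_holds h4⟩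


/-! ## §12 (gen 3) Height zero of line `embed-dont-dissolve` is the kill switch; Schoenflies spheres are useless -/

/-- The puncture `X ∖ {q}` as an open submanifold (same term as the skeleton's `punctureAt q` and as
the set written out in its `stub_sliceDiscIn_transport_puncture`). [folklore] -/
abbrev puncture {X : Type} [TopologicalSpace X] [T1Space X] (q : X) : TopologicalSpace.Opens X :=
  ⟨{q}ᶜ, isOpen_compl_singleton⟩

/-- **LEMMA S (Schoenflies spheres are useless for H-sliceness).**  If `K` bounds a smooth proper
disc off a ball in a smooth 4-manifold `X` (`K.IsSliceDiscIn X e f`) and SOME puncture `X ∖ {q}` off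
the ball and the disc embeds smoothly in a 4-manifold `P` diffeomorphic to `S⁴` (the height-`0`
towers of the skeleton: `IsTower o 0 P oP := Nonempty (P ≃ₘ S⁴)`; orientations irrelevant), then `K`
is smoothly slice.  Proof: corestrict the slice data to the open submanifold `X ∖ {q}`
(`IsSliceDiscIn.codRestrict`), push them into `P` along the embedding
(`IsSliceDiscIn.comp_isSmoothEmbedding`), and apply Palais' disc theorem in `P ≅ S⁴`
(`isSmoothlySlice_of_isSliceDiscIn_of_diffeomorph`, §5): the image of the ball is a round-chart ball
of `S⁴`, whose complement is a standard `B⁴` containing the image of the disc.  No hypothesis on `X`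
(it need not be compact, simply connected, or a homotopy sphere).  In particular: a knot slice in a
SCHOENFLIES BALL `B` (closure of a complementary region of a smooth `S³ ⊂ S⁴`) is slice — apply the
lemma to `X = B ∪_∂ B⁴` punctured at the centre of the capping ball, `X ∖ {q} ≅ B ∪ collar ⊂ S⁴`;
the naive argument ("`K` bounds a disc in `S⁴ ∖` the OTHER Schoenflies ball") needs the smooth
Schoenflies conjecture, this one does not, because sliceness in `X` does not depend on the removed
ball (Palais/Cerf inside `S⁴` after the transport). [cite: Palais1960, Thm. B] -/
theorem isSmoothlySlice_of_isSliceDiscIn_of_puncture_embeds_heightZero {K : Knot} {X : Type}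
    [TopologicalSpace X] [T2Space X] [ChartedSpace (𝔼 4) X] [IsManifold (𝓡 4) ∞ X]
    {e : 𝔼 4 → X} {f : 𝔼 2 → X} (h : K.IsSliceDiscIn X e f) {q : X} (hqe : q ∉ range e)
    (hqf : q ∉ range f) {P : Type} [TopologicalSpace P] [ChartedSpace (𝔼 4) P]
    [IsManifold (𝓡 4) ∞ P] (φ : P ≃ₘ⟮𝓡 4, 𝓡 4⟯ 𝕊⁴) {j : ↥(puncture q) → P}
    (hj : Manifold.IsSmoothEmbedding (𝓡 4) (𝓡 4) ∞ j) : K.IsSmoothlySlice := by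
  have heU : ∀ v, e v ∈ puncture q := by
    intro v (hv : e v ∈ ({q} : Set X))
    exact hqe ⟨v, hv⟩
  have hfU : ∀ y, f y ∈ puncture q := by
    intro y (hy : f y ∈ ({q} : Set X))
    exact hqf ⟨y, hy⟩
  exact isSmoothlySlice_of_isSliceDiscIn_of_diffeomorph
    ((h.codRestrict (puncture q) heU hfU).comp_isSmoothEmbedding hj) φ

/-- **Lemma S for `S⁴` itself**: slice data in `X` plus a smooth embedding `X ∖ {q} ↪ S⁴` off the data
give sliceness. [cite: Palais1960, Thm. B] -/
theorem isSmoothlySlice_of_isSliceDiscIn_of_puncture_embeds_sphere {K : Knot} {X : Type}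
    [TopologicalSpace X] [T2Space X] [ChartedSpace (𝔼 4) X] [IsManifold (𝓡 4) ∞ X]
    {e : 𝔼 4 → X} {f : 𝔼 2 → X} (h : K.IsSliceDiscIn X e f) {q : X} (hqe : q ∉ range e)
    (hqf : q ∉ range f) {ι : ↥(puncture q) → 𝕊⁴}
    (hι : Manifold.IsSmoothEmbedding (𝓡 4) (𝓡 4) ∞ ι) : K.IsSmoothlySlice :=
  isSmoothlySlice_of_isSliceDiscIn_of_puncture_embeds_heightZero h hqe hqf (Diffeomorph.refl _ _ _) hι

/-- Contrapositive, the profile of an FGMW sphere: **if `K` is NOT slice, then no 4-manifold in which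
`K` bounds a disc off a ball has a puncture (off the data) that embeds in `S⁴`** — such an `X` is not
`S⁴`, not a Schoenflies sphere `B ∪ B⁴` (`B ⊂ S⁴`), and more generally admits no smooth embedding
`X ∖ {pt} ↪ S⁴`. [cite: FreedmanGompfMorrisonWalker2010, §1] -/
theorem not_puncture_embeds_sphere_of_not_isSmoothlySlice {K : Knot} (hK : ¬ K.IsSmoothlySlice)
    {X : Type} [TopologicalSpace X] [T2Space X] [ChartedSpace (𝔼 4) X] [IsManifold (𝓡 4) ∞ X]
    {e : 𝔼 4 → X} {f : 𝔼 2 → X} (h : K.IsSliceDiscIn X e f) {q : X} (hqe : q ∉ range e)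
    (hqf : q ∉ range f) (ι : ↥(puncture q) → 𝕊⁴) :
    ¬ Manifold.IsSmoothEmbedding (𝓡 4) (𝓡 4) ∞ ι :=
  fun hι ↦ hK (isSmoothlySlice_of_isSliceDiscIn_of_puncture_embeds_sphere h hqe hqf hι)

/-- **HEIGHT-ZERO BET of line `embed-dont-dissolve`** (the registered bet `stub_puncturedPairSphereEmbeds`
with the tower height frozen at `0`, orientations dropped, and the Manolescu–Piccirillo datum
weakened to ANY ambient manifold): on every `0`-surgery pair `(K, K')` with `K` smoothly slice, `K'`
bounds a smooth proper disc off a ball in SOME smooth 4-manifold `X` some puncture of which, off the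
ball and the disc, embeds smoothly in `S⁴`.  [cite: ManolescuPiccirillo2023, Lemma 3.5 and Thm. 3.9] -/
def HeightZeroBet : Prop :=
  ∀ (K K' : Knot) (Y : Type) [TopologicalSpace Y] [ChartedSpace (𝔼 3) Y],
    IsIntegralSurgery (𝓡 3) Y K 0 → IsIntegralSurgery (𝓡 3) Y K' 0 → K.IsSmoothlySlice →
      ∃ (X : Type) (_ : TopologicalSpace X) (_ : T2Space X) (_ : ChartedSpace (𝔼 4) X)
        (_ : IsManifold (𝓡 4) ∞ X) (e : 𝔼 4 → X) (f : 𝔼 2 → X) (q : X)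
        (ι : ↥(puncture q) → 𝕊⁴),
        K'.IsSliceDiscIn X e f ∧ q ∉ range e ∧ q ∉ range f ∧
          Manifold.IsSmoothEmbedding (𝓡 4) (𝓡 4) ∞ ι

/-- **The height-zero bet is the route's KILL SWITCH `Assembly2` in costume (⇒).**  Unconditional
(Lemma S). So the whole content of the picked line lies in the passage from height `0` to height
`≥ 1` (one `ℂℙ²`-summand for odd Boyer parity); at height `0` it would prove that the `0`-surgery
type determines sliceness and close the route `refuted:ZseThesis`. [folklore] -/
theorem assembly2_of_heightZeroBet (h : HeightZeroBet) : Assembly2 := by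
  intro K K' Y _ _ h1 h2 h3
  obtain ⟨X, _, _, _, _, e, f, q, ι, hef, hqe, hqf, hι⟩ := h K K' Y h1 h2 h3
  exact isSmoothlySlice_of_isSliceDiscIn_of_puncture_embeds_sphere hef hqe hqf hι

/-- **A slice knot is slice in `S⁴` off a round ball, with data missing a point, and the puncture
embeds in `S⁴` by the identity** (`IsSliceDisc.isSliceDiscIn_sphere`, `IsSliceDiscIn.exists_notMem_range`,
`Manifold.IsSmoothEmbedding.of_opens`).  Unconditional. [cite: ManolescuPiccirillo2023, §2 (remark after Def. 2.1)] -/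
theorem exists_puncture_embeds_of_isSmoothlySlice {K : Knot} (hK : K.IsSmoothlySlice) :
    ∃ (X : Type) (_ : TopologicalSpace X) (_ : T2Space X) (_ : ChartedSpace (𝔼 4) X)
      (_ : IsManifold (𝓡 4) ∞ X) (e : 𝔼 4 → X) (f : 𝔼 2 → X) (q : X) (ι : ↥(puncture q) → 𝕊⁴),
      K.IsSliceDiscIn X e f ∧ q ∉ range e ∧ q ∉ range f ∧
        Manifold.IsSmoothEmbedding (𝓡 4) (𝓡 4) ∞ ι := by
  obtain ⟨g, hg⟩ := hK
  let a : 𝕊⁴ := ⟨EuclideanSpace.single 0 1, by simp⟩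
  have h0 := hg.isSliceDiscIn_sphere a
  haveI : SimplyConnectedSpace 𝕊⁴ := simplyConnectedSpace_sphere_four_holds
  obtain ⟨φ, e', -, h', -, hqe, hqf⟩ := h0.exists_notMem_range a
  exact ⟨𝕊⁴, _, inferInstance, _, inferInstance, _, _, a, Subtype.val, h', hqe, hqf,
    Manifold.IsSmoothEmbedding.of_opens _⟩

/-- **(⇐) Conversely the kill switch gives the height-zero bet.**  Unconditional. [folklore] -/
theorem heightZeroBet_of_assembly2 (hA : Assembly2) : HeightZeroBet :=
  fun K K' Y _ _ h1 h2 h3 ↦ exists_puncture_embeds_of_isSmoothlySlice (hA K K' Y h1 h2 h3)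

/-- **Height zero ⟺ kill switch ⟺ ¬(route thesis).** [folklore] -/
theorem heightZeroBet_iff_assembly2 : HeightZeroBet ↔ Assembly2 :=
  ⟨assembly2_of_heightZeroBet, heightZeroBet_of_assembly2⟩

/-- Hence the height-zero bet is refuted by exactly the route's thesis X, and by nothing less. [folklore] -/
theorem heightZeroBet_iff_not_zseThesis : HeightZeroBet ↔ ¬ ZseThesis :=
  heightZeroBet_iff_assembly2.trans assembly2_iff_not_zseThesis

/-- The height-zero bet (with Rasmussen's theorem) implies the crux — as it must, being the kill
switch. [cite: Rasmussen2010, Thm. 1] -/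
theorem crux_of_heightZeroBet (hR : eq_zero_of_isSmoothlySlice) (h : HeightZeroBet) : Crux :=
  crux_of_assembly2 hR (assembly2_of_heightZeroBet h)

/-- **COUNTEREXAMPLE PROFILE, sharpened (gen 3).**  Given Rasmussen's theorem, a counterexample to the
crux is a pair `(K, K', Y, s)` with `K` slice, `s(K') = s ≠ 0`, such that EVERY smooth 4-manifold `X`
in which `K'` bounds a disc off a ball — in particular the Manolescu–Piccirillo homotopy sphere
`X₀(K') ∪_Y (B⁴ ∖ νD)` of the pair, for every slice disc `D` and every identification — has NO
puncture embedding smoothly in `S⁴`: it is an exotic `S⁴` that is not of Schoenflies type `B ∪ B⁴`,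
`B ⊂ S⁴`.  (Compare §6: not a Gluck twist either, by MMSW Cor. 1.13.) [cite: FreedmanGompfMorrisonWalker2010, §1] -/
theorem counterexample_not_schoenflies (hR : eq_zero_of_isSmoothlySlice) (h : ¬ Crux) :
    ∃ (K K' : Knot) (Y : Type) (_ : TopologicalSpace Y) (_ : ChartedSpace (𝔼 3) Y) (s : ℤ),
      IsIntegralSurgery (𝓡 3) Y K 0 ∧ IsIntegralSurgery (𝓡 3) Y K' 0 ∧ K.IsSmoothlySlice ∧
        K'.HasRasmussenInvariant s ∧ s ≠ 0 ∧
        ∀ (X : Type) [TopologicalSpace X] [T2Space X] [ChartedSpace (𝔼 4) X] [IsManifold (𝓡 4) ∞ X]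
          (e : 𝔼 4 → X) (f : 𝔼 2 → X) (q : X) (ι : ↥(puncture q) → 𝕊⁴),
          K'.IsSliceDiscIn X e f → q ∉ range e → q ∉ range f →
            ¬ Manifold.IsSmoothEmbedding (𝓡 4) (𝓡 4) ∞ ι := by
  obtain ⟨K, K', Y, _, _, s, h1, h2, h3, h4, h5⟩ := not_crux_iff_cruxRasmussen.1 h
  refine ⟨K, K', Y, _, _, s, h1, h2, h3, h4, h5, fun X _ _ _ _ e f q ι hef hqe hqf ↦ ?_⟩
  exact not_puncture_embeds_sphere_of_not_isSmoothlySlice (fun h6 ↦ h5 (hR h4 h6)) hef hqe hqf ι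

/-- **The FGMW strategy needs a non-Schoenflies sphere** (general form, for the Barriers catalogue):
given Rasmussen's theorem, a knot slice in a homotopy ball with `s ≠ 0` is slice only in 4-manifolds
NO puncture of which embeds in `S⁴`.  So homotopy spheres of the form `B ∪_∂ B⁴` with `B` a
Schoenflies ball — the spheres the smooth Schoenflies problem is about — can never carry the
strategy, independently of whether `B` is standard. [cite: FreedmanGompfMorrisonWalker2010, §1] -/
theorem fgmw_sphere_not_schoenflies (hR : eq_zero_of_isSmoothlySlice)
    (h : Literature.Barriers.SmoothPoincare4.FGMWRasmussenStrategy) :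
    ∃ (K : Knot) (s : ℤ), K.IsHomotopyBallSlice ∧ K.HasRasmussenInvariant s ∧ s ≠ 0 ∧
      ∀ (X : Type) [TopologicalSpace X] [T2Space X] [ChartedSpace (𝔼 4) X] [IsManifold (𝓡 4) ∞ X]
        (e : 𝔼 4 → X) (f : 𝔼 2 → X) (q : X) (ι : ↥(puncture q) → 𝕊⁴),
        K.IsSliceDiscIn X e f → q ∉ range e → q ∉ range f →
          ¬ Manifold.IsSmoothEmbedding (𝓡 4) (𝓡 4) ∞ ι := by
  obtain ⟨K, hK, s, hs, hs0⟩ := h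
  exact ⟨K, s, hK, hs, hs0, fun X _ _ _ _ e f q ι hef hqe hqf ↦
    not_puncture_embeds_sphere_of_not_isSmoothlySlice (fun h6 ↦ hs0 (hR hs h6)) hef hqe hqf ι⟩

/-- **Slice in a Schoenflies-type sphere ⟺ slice** (the `IsHomotopyBallSlice`-shaped statement): a knot
bounds a disc off a ball in some smooth 4-manifold with an `S⁴`-embeddable puncture iff it is smoothly
slice.  Unconditional.  (`IsHomotopyBallSlice` drops the embeddability and is the OPEN notion.) [cite: Palais1960, Thm. B] -/
theorem exists_isSliceDiscIn_puncture_embeds_iff (K : Knot) :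
    (∃ (X : Type) (_ : TopologicalSpace X) (_ : T2Space X) (_ : ChartedSpace (𝔼 4) X)
        (_ : IsManifold (𝓡 4) ∞ X) (e : 𝔼 4 → X) (f : 𝔼 2 → X) (q : X) (ι : ↥(puncture q) → 𝕊⁴),
        K.IsSliceDiscIn X e f ∧ q ∉ range e ∧ q ∉ range f ∧
          Manifold.IsSmoothEmbedding (𝓡 4) (𝓡 4) ∞ ι) ↔ K.IsSmoothlySlice := by
  constructor
  · rintro ⟨X, _, _, _, _, e, f, q, ι, hef, hqe, hqf, hι⟩
    exact isSmoothlySlice_of_isSliceDiscIn_of_puncture_embeds_sphere hef hqe hqf hι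
  · exact exists_puncture_embeds_of_isSmoothlySlice

/-! ## §13 (gen 3) Audit of the lead's Theorem A (bet analysis of `stub_puncturedPairSphereEmbeds`); the census it implies -/

/-- **Smoothly `ℤ`-slice**: `K` bounds a smooth slice disc `g` whose open exterior
`B̊⁴ ∖ g(𝔻²)` (`sliceDiscExterior g`, = the interior of Manolescu–Piccirillo's `V = B⁴ ∖ νD`) has
infinite cyclic fundamental group.  Examples (paper): the unknot; every Whitehead double `Wh±(J)` of a
smoothly slice knot `J` (the double of the concordance is a disc inside `νD_J ≅ B⁴`, standard for the
unknotted pattern, and van Kampen over `∂νD_J ∩ B⁴ = D_J × S¹` kills `π₁(B⁴ ∖ νD_J)` because the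
pattern has winding number `0`); necessary condition `Δ_K = 1` (Freedman: `Δ_K = 1` iff TOPOLOGICALLY
`ℤ`-slice). [cite: ConwayPowell2021, §1 (homotopy ribbon ℤ-discs)] -/
def IsSmoothlyZSlice (K : Knot) : Prop :=
  ∃ g : 𝔼 2 → 𝔼 4, K.IsSliceDisc g ∧
    ∃ x : ↥(sliceDiscExterior g),
      Nonempty (FundamentalGroup (↥(sliceDiscExterior g)) x ≃* Multiplicative ℤ)

/-- A smoothly `ℤ`-slice knot is smoothly slice. [folklore] -/
theorem IsSmoothlyZSlice.isSmoothlySlice {K : Knot} (h : IsSmoothlyZSlice K) : K.IsSmoothlySlice := by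
  obtain ⟨g, hg, -⟩ := h
  exact ⟨g, hg⟩

/-- HYPOTHESIS `H_CorB` — **the lead's Corollary B** (prover-line-stmt-SmoothPoincare4-0368-0,
`Cruxes/ZseSVanishesOnPairs/NOTES.md` §1, 2026-08-16; a PAPER theorem of this project, not in print and
not formalised): on a `0`-surgery pair whose slice member `K` is smoothly `ℤ`-slice, `s(K') = 0` —
indeed `K'` is smoothly SLICE when the Boyer / Manolescu–Piccirillo parity of the identification is even,
and H-slice in both `ℂℙ²` and `ℂℙ²bar` when it is odd.  It is the case `π₁(B⁴ ∖ D'') ≅ ℤ` of the lead's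
Theorem A (hypothesis (B1'): the dual curve `γ = φ(μ_{K'})` is conjugate to `μ_K^{±1}` in
`π₁(B⁴ ∖ D'')` for SOME slice disc `D''` of `K`).  GEN-3 AUDIT of the paper proof, step by step —
(i) van Kampen: `π₁(X₀(K) ∖ ν(D ∪ D'')) ≅ π₁(B⁴ ∖ D'')`, the `0`-framed longitude dying on both sides,
the meridian of the sphere `S = D ∪ D''` going to `μ_K`; (ii) (B1') ⇒ an immersed disc `Δ₀ ⊂ X₀(K)`
for `γ` meeting `S` transversally once (immersed annulus of the free homotopy, capped by a normal fibre
disc); (iii) Norman's trick along disjoint parallel copies `S × {vᵢ}` of the square-`0` sphere `S`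
(trivial normal bundle), one copy per double point, tubes of radius below the spacing of the copies ⇒
an EMBEDDED disc `Δ₁`, still with a once-met parallel copy; (iv) resolving `Δ₁ ∩ (±S × {v})` realises
every class `[Δ₁] + a[S]`, `Q` moving by `±2`: embedded discs of every framing defect
`n ≡ p(φ) (mod 2)` (Whitney–Massey; `p(φ)` = MP Def. 3.8 parity, Boyer); (v) `n = 0`: the pair ball
`B_X = V ∪_γ h` is `V ∪ ν(Δ) ⊂ S⁴`, so `X ∖ {pt} ↪ S⁴` and `K'` is SLICE — by Lemma S of §12
(`isSmoothlySlice_of_isSliceDiscIn_of_puncture_embeds_sphere`), NOT by a Schoenflies argument on the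
complementary region; (vi) `n = ±1`: one blow-up of a smooth point of `Δ` in `ℂℙ²bar`, resp. `ℂℙ²`,
gives `n = 0` in `X₀(K) # ℂℙ²bar`, resp. `# ℂℙ²`, hence `X ∖ {pt} ↪ ℂℙ²bar` and `↪ ℂℙ²`, `K'` H-slice in
both (its disc lies in the punctured homotopy ball, `H₂ = 0`), and `s(K') = 0` by MMSW Cor. 1.9 at
`t = 1` plus Remark 6.6.  NO GAP FOUND.  NOVELTY (searched: the held texts of MP 2023 §3 — Lemma 3.3,
3.5, 3.7, Thm. 3.9, Def. 3.14 / Thm. 3.15 Property U —, Nakamura 2023 §3 — Lemma 3.1, Cor. 3.2,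
Lemma 3.5: the dual curve `(m, k)` must be slice IN THE 0-HANDLE or in an auxiliary closed `W`, never
through parallel copies of `D`, no `π₁` hypothesis —, DG 2025 §5, MMSW §§6, 9; remote indices
unreachable this session, `search-degraded: searchd`): not found in print; nearest classical tool
Norman 1969 / Freedman–Quinn §1.9.  So on the sub-class {`K` smoothly `ℤ`-slice} the crux is (paper-)
settled, and by `counterexample_not_ZSlice` a crux-2 witness needs a slice `K` that is NOT smoothly
`ℤ`-slice (more precisely: non-meridional dual curve for every slice disc).  CHEAPEST EXTERNAL TEST
of Theorem A / Corollary B (needs KnotJob-level `s` and SnapPy, not on this hub): for a slice `C` (e.g.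
`6₁`, `3₁ # 3̄₁`) the double `Wh±(C)` is smoothly `ℤ`-slice and has the annulus presentation "0-framed
annulus with core `C` + clasp band" in the general sense of MP 2023 §4.2, so its annulus twists `J_n` are
`0`-friends of `Wh±(C)`; Corollary B predicts `s(J_n) = 0` for all `n` (as the crux does) AND `J_n`
smoothly slice whenever the twist homeomorphism is even (parity per MP §4.3) — one `J_n` with `τ`, `ε`, `ν⁺`
or `s ≠ 0` at even parity refutes Theorem A as a paper claim (or is an exotic `S⁴`). [cite: ManolescuPiccirillo2023, Def. 3.8, Thm. 3.9, Lemma 3.5 and §4.2] -/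
def CorollaryB : Prop :=
  ∀ (K K' : Knot) (Y : Type) [TopologicalSpace Y] [ChartedSpace (𝔼 3) Y] (s : ℤ),
    IsIntegralSurgery (𝓡 3) Y K 0 → IsIntegralSurgery (𝓡 3) Y K' 0 → IsSmoothlyZSlice K →
      K'.HasRasmussenInvariant s → s = 0

/-- Corollary B is a sub-case of the crux (so it is at least consistent with everything the crux
implies, e.g. Rasmussen's theorem on `ℤ`-slice knots). [folklore] -/
theorem corollaryB_of_crux (h : Crux) : CorollaryB :=
  fun K K' Y _ _ s h1 h2 h3 h4 ↦ h K K' Y s h1 h2 h3.isSmoothlySlice h4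

/-- **CENSUS (gen 3): modulo Corollary B, a counterexample to the crux has its slice knot `K` NOT
smoothly `ℤ`-slice** (no slice disc with infinite cyclic exterior group; in particular `K` is not a
Whitehead double of a slice knot, and if `Δ_K = 1` all its smooth slice discs have non-abelian group).
Pure logic over `H_CorB`. [folklore] -/
theorem counterexample_not_ZSlice (hB : CorollaryB) (h : ¬ Crux) :
    ∃ (K K' : Knot) (Y : Type) (_ : TopologicalSpace Y) (_ : ChartedSpace (𝔼 3) Y) (s : ℤ),
      IsIntegralSurgery (𝓡 3) Y K 0 ∧ IsIntegralSurgery (𝓡 3) Y K' 0 ∧ K.IsSmoothlySlice ∧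
        ¬ IsSmoothlyZSlice K ∧ K'.HasRasmussenInvariant s ∧ s ≠ 0 := by
  obtain ⟨K, K', Y, _, _, s, h1, h2, h3, h4, h5⟩ := not_crux_iff_cruxRasmussen.1 h
  exact ⟨K, K', Y, _, _, s, h1, h2, h3, fun hZ ↦ h5 (hB K K' Y s h1 h2 hZ h4), h4, h5⟩

/-- The same census as a vanishing class in the sense of §11: `P K K' Y := IsSmoothlyZSlice K`.
[folklore] -/
theorem corollaryB_as_vanishingClass (hB : CorollaryB) :
    ∀ (K K' : Knot) (Y : Type) [TopologicalSpace Y] [ChartedSpace (𝔼 3) Y] (s : ℤ),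
      IsSmoothlyZSlice K → IsIntegralSurgery (𝓡 3) Y K 0 → IsIntegralSurgery (𝓡 3) Y K' 0 →
        K.IsSmoothlySlice → K'.HasRasmussenInvariant s → s = 0 :=
  fun K K' Y _ _ s hp h1 h2 _ h4 ↦ hB K K' Y s h1 h2 hp h4


/-! ## §14 (gen 4) Seeds with a characterising `0`-slope are a vanishing class; the 2025–26 literature census -/

/-- **`0` is a characterising slope for `K`, in the tree's orientation-blind sense.**  Every knot
`K'` that shares a `0`-surgery with `K` in the sense of the crux (some `ℝ³`-charted `Y` is
`0`-surgery on both; by §7 this allows `S³₀(K') ≅ -S³₀(K)`) is isotopic to `K` or to its mirror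
image `K̄`.  IN PRINT (orientation-preserving version, mirrors listed separately, so this
up-to-mirror form follows): the unknot, the trefoils and the figure eight (Gabai 1987: `S³₀(K)`
detects genus and fibredness), `5₂` (Baldwin–Sivek 2022), and — Baldwin–Sivek, *Zero-surgery
characterizes infinitely many knots*, Math. Res. Lett. **31** (2024), Thm. 1.1 — `15n43522`,
`Wh±(T₂,₃, 2)` and ALL the pretzel knots `P(-3, 3, 2n+1)`, `n ∈ ℤ`, together with their mirrors;
the `P(-3,3,2n+1)` are smoothly SLICE (ribbon, genus `1`, `Δ = -2t + 5 - 2t⁻¹`), and by their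
Prop. 5.5 every slope `r ∈ ℚ` distinguishes them from one another.  Not constructible in the
tree (no pretzel knots, no Heegaard Floer theory), hence a precise `Prop`.
[cite: BaldwinSivek2024, Thm. 1.1 (arXiv:2211.04280)] -/
def IsZeroCharacterised (K : Knot) : Prop :=
  ∀ (K' : Knot) (Y : Type) [TopologicalSpace Y] [ChartedSpace (𝔼 3) Y],
    IsIntegralSurgery (𝓡 3) Y K 0 → IsIntegralSurgery (𝓡 3) Y K' 0 →
      K'.IsIsotopic K ∨ K'.IsIsotopic K.mirror

/-- The class of `0`-characterised knots is closed under mirror image (as it must be, the pair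
relation being orientation-blind, §7): unconditional, from `isIntegralSurgery_zero_mirror_iff`
and `K̄̄ = K`. [folklore] -/
theorem IsZeroCharacterised.mirror {K : Knot} (h : IsZeroCharacterised K) :
    IsZeroCharacterised K.mirror := by
  intro K' Y _ _ h1 h2
  rw [show K.mirror.mirror = K from SphereEmbedding.mirror_mirror K]
  exact (h K' Y ((isIntegralSurgery_zero_mirror_iff K).1 h1) h2).symm

/-- **ON `0`-CHARACTERISED SEEDS THE KILL SWITCH `Assembly2` HOLDS — UNCONDITIONALLY.**  If `0`
characterises `K` up to mirror, every `0`-friend `K'` of the slice knot `K` is isotopic to the slice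
knot `K` or to the slice knot `K̄` (`isSmoothlySlice_mirror`, §7), hence itself smoothly slice
(sliceness is an isotopy invariant: the DISCHARGED `Knot.IsSmoothlySlice.of_isIsotopic_holds`).  No
Rasmussen, no Khovanov: on this class the `0`-surgery type determines sliceness for the trivial reason
that it determines the knot.  With Baldwin–Sivek Thm. 1.1: no pretzel knot `P(-3,3,2n+1)` seeds a
witness of the route's THESIS `ZseThesis` either (`zseThesis_seed_not_zeroCharacterised`).
[cite: BaldwinSivek2024, Thm. 1.1 (arXiv:2211.04280)] -/
theorem isSmoothlySlice_partner_of_zeroCharacterised {K K' : Knot} {Y : Type} [TopologicalSpace Y]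
    [ChartedSpace (𝔼 3) Y] (hK : IsZeroCharacterised K) (h1 : IsIntegralSurgery (𝓡 3) Y K 0)
    (h2 : IsIntegralSurgery (𝓡 3) Y K' 0) (h3 : K.IsSmoothlySlice) : K'.IsSmoothlySlice := by
  rcases hK K' Y h1 h2 with hi | hi
  · exact Knot.IsSmoothlySlice.of_isIsotopic_holds (SphereEmbedding.IsIsotopic.symm_holds hi) h3
  · exact Knot.IsSmoothlySlice.of_isIsotopic_holds (SphereEmbedding.IsIsotopic.symm_holds hi)
      (isSmoothlySlice_mirror h3)

/-- **The route's thesis X cannot be seeded by a `0`-characterised slice knot** (unconditional): in any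
witness `(K, K', Y)` of `ZseThesis` (`K` slice, `K'` not), `0` is not a characterising slope of `K` up to
mirror, and `K'` is isotopic neither to `K` nor to `K̄`.  Printed exclusions: `U` (Property R),
`P(-3,3,2n+1)` for all `n` (Baldwin–Sivek). [cite: BaldwinSivek2024, Thm. 1.1 (arXiv:2211.04280)] -/
theorem zseThesis_seed_not_zeroCharacterised (h : ZseThesis) :
    ∃ (K K' : Knot) (Y : Type) (_ : TopologicalSpace Y) (_ : ChartedSpace (𝔼 3) Y),
      IsIntegralSurgery (𝓡 3) Y K 0 ∧ IsIntegralSurgery (𝓡 3) Y K' 0 ∧ K.IsSmoothlySlice ∧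
        ¬ K'.IsSmoothlySlice ∧ ¬ IsZeroCharacterised K ∧ ¬ K'.IsIsotopic K ∧ ¬ K'.IsIsotopic K.mirror := by
  obtain ⟨K, K', Y, _, _, h1, h2, h3, h4⟩ := h
  refine ⟨K, K', Y, _, _, h1, h2, h3, h4,
    fun hZ ↦ h4 (isSmoothlySlice_partner_of_zeroCharacterised hZ h1 h2 h3), fun hi ↦ h4 ?_, fun hi ↦ h4 ?_⟩
  · exact Knot.IsSmoothlySlice.of_isIsotopic_holds (SphereEmbedding.IsIsotopic.symm_holds hi) h3
  · exact Knot.IsSmoothlySlice.of_isIsotopic_holds (SphereEmbedding.IsIsotopic.symm_holds hi)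
      (isSmoothlySlice_mirror h3)

/-- **SEEDS WITH A CHARACTERISING `0`-SLOPE FORM A VANISHING CLASS** (modulo Rasmussen's
theorem only): if `0` characterises the slice knot `K` up to mirror, every `0`-friend `K'` of `K`
is itself smoothly slice (`isSmoothlySlice_partner_of_zeroCharacterised`, unconditional), so each
Rasmussen invariant of `K'` vanishes by Rasmussen's theorem applied to `K'`.  With
Baldwin–Sivek Thm. 1.1 this settles the crux IN PRINT on the infinite family of slice seeds
`K = P(-3, 3, 2n+1)`: they have no non-trivial `0`-friend whatsoever — the first infinite family
of non-trivial slice knots provably useless as seeds for crux 2, by a mechanism (Dehn-surgery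
characterisation via the Baldwin–Sivek classification of genus-1 nearly fibred knots,
`dim HFK^(K, 1) = 2`) different from every vanishing mechanism listed in §§6, 11, 13 (Gluck /
(super-)special RBG / `ℤ`-slice-meridional).  The unknot seed is the case Property R (sibling
file `Cruxes/ZseCruxRasmussen/Disproof.lean` §12, and `isZeroCharacterised_unknot_of` below).
CENSUS CONSEQUENCE (`counterexample_seed_not_zeroCharacterised`): the slice member of a
counterexample has a NON-characterising `0`-slope — of course (its partner has `s ≠ 0 = s(K) =
s(K̄)`), but now with a printed infinite exclusion list and a practical filter for searches in the
style of Kegel–Spreer 2026: discard genus-1 seeds with `dim HFK^(K,1) = 2`.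
[cite: BaldwinSivek2024, Thm. 1.1 (arXiv:2211.04280)] [cite: Rasmussen2010, Thm. 1] -/
theorem crux_on_zeroCharacterised (hR : eq_zero_of_isSmoothlySlice) {K K' : Knot} {Y : Type}
    [TopologicalSpace Y] [ChartedSpace (𝔼 3) Y] {s : ℤ} (hK : IsZeroCharacterised K)
    (h1 : IsIntegralSurgery (𝓡 3) Y K 0) (h2 : IsIntegralSurgery (𝓡 3) Y K' 0)
    (h3 : K.IsSmoothlySlice) (h4 : K'.HasRasmussenInvariant s) : s = 0 :=
  hR h4 (isSmoothlySlice_partner_of_zeroCharacterised hK h1 h2 h3)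

/-- The same statement as a vanishing class in the format of §11 (`P K K' Y := IsZeroCharacterised K`),
ready for `not_isSmoothlySlice_of_vanishingClass` / `counterexample_avoids_vanishingClass`.
[cite: BaldwinSivek2024, Thm. 1.1 (arXiv:2211.04280)] -/
theorem zeroCharacterised_vanishingClass (hR : eq_zero_of_isSmoothlySlice) :
    ∀ (K K' : Knot) (Y : Type) [TopologicalSpace Y] [ChartedSpace (𝔼 3) Y] (s : ℤ),
      IsZeroCharacterised K → IsIntegralSurgery (𝓡 3) Y K 0 → IsIntegralSurgery (𝓡 3) Y K' 0 →
        K.IsSmoothlySlice → K'.HasRasmussenInvariant s → s = 0 :=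
  fun _ _ _ _ _ _ hp h1 h2 h3 h4 ↦ crux_on_zeroCharacterised hR hp h1 h2 h3 h4

/-- **CENSUS (gen 4): the slice member `K` of any counterexample has a non-characterising
`0`-slope, and the partner `K'` is isotopic neither to `K` nor to `K̄`** (given Rasmussen's
theorem).  Printed exclusions for `K`: `U` (Gabai), `P(-3,3,2n+1)` for all `n` (Baldwin–Sivek 2024,
Thm. 1.1); printed NON-exclusions (slice knots that DO have non-isotopic `0`-friends, i.e. where a
partner could in principle live): `6₁`, `8₈`, `8₉`, `8₂₀`, `9₂₇`, `9₄₁`, `9₄₆`, `10₃`, … — every slice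
knot admits annulus presentations and hence infinitely many `0`-friends by Osoinach's annulus
twisting whenever the presentation is non-trivial (Abe–Jong–Omae–Takeuchi 2013; MP 2023 §4), and
Kegel–Spreer 2026 tabulate `0`-friends of all low-crossing knots. [cite: BaldwinSivek2024, Thm. 1.1 (arXiv:2211.04280)]
[cite: KegelSpreer2026, §4 (arXiv:2603.22438)] -/
theorem counterexample_seed_not_zeroCharacterised (hR : eq_zero_of_isSmoothlySlice) (h : ¬ Crux) :
    ∃ (K K' : Knot) (Y : Type) (_ : TopologicalSpace Y) (_ : ChartedSpace (𝔼 3) Y) (s : ℤ),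
      IsIntegralSurgery (𝓡 3) Y K 0 ∧ IsIntegralSurgery (𝓡 3) Y K' 0 ∧ K.IsSmoothlySlice ∧
        K'.HasRasmussenInvariant s ∧ s ≠ 0 ∧ ¬ IsZeroCharacterised K ∧
        ¬ K'.IsIsotopic K ∧ ¬ K'.IsIsotopic K.mirror := by
  obtain ⟨K, K', Y, _, _, s, h1, h2, h3, h4, h5⟩ := not_crux_iff_cruxRasmussen.1 h
  refine ⟨K, K', Y, _, _, s, h1, h2, h3, h4, h5,
    fun hZ ↦ h5 (crux_on_zeroCharacterised hR hZ h1 h2 h3 h4), fun hi ↦ h5 ?_, fun hi ↦ h5 ?_⟩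
  · exact hR (h4.of_isIsotopic (SphereEmbedding.IsIsotopic.symm_holds hi)) h3
  · exact hR (h4.of_isIsotopic (SphereEmbedding.IsIsotopic.symm_holds hi))
      (isSmoothlySlice_mirror h3)

/-- **The unknot is `0`-characterised, modulo Property R in friend form** (Gabai 1987, Cor. 8.3:
a knot sharing a `0`-surgery with the unknot is unknotted; stated over the crux's own `ℝ³`-charted
`Y` exactly as the sibling file's `PropertyRFriendForm`, because the tree's named fact
`isUnknot_of_isIntegralSurgery_zero` lives on the product model of `S² × S¹` and the transport of
`IsIntegralSurgery` across models on different vector spaces is not in the tree).  So the two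
printed seed exclusions — Property R and Baldwin–Sivek — are instances of ONE formal class.
[cite: GabaiJDG1987, Cor. 8.3] -/
theorem isZeroCharacterised_unknot_of
    (hPR : ∀ (K' : Knot) (Y : Type) [TopologicalSpace Y] [ChartedSpace (𝔼 3) Y],
      IsIntegralSurgery (𝓡 3) Y unknot 0 → IsIntegralSurgery (𝓡 3) Y K' 0 → K'.IsUnknot) :
    IsZeroCharacterised unknot :=
  fun K' Y _ _ h1 h2 ↦ Or.inl (hPR K' Y h1 h2)

/-- **LITERATURE CENSUS 2025–26 (gen 4 sweep, 2026-08-16; forward-citation graphs of MP 2023,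
MMSW 2023, Nakamura 2023, DG 2025, FGMW 2010 through arXiv 2606.*; `searchd`/arXiv API degraded,
local graph used).**  Nothing in print proves or refutes the crux; MMSW Question 9.11 is still open.
New items relative to §§6, 8, 11 (recorded for provers and for the next sweep):
(1) NEW SUPPLY FAMILY outside the Nakamura/Dunfield–Gong vanishing classes: Qin's *peculiar RBG
links* `{(U, 1/s), (B, b), (G, g)}`, `B, G` meridians of `R = U`, `b = g = s ± 1`,
`n = ±(1 - (s - l)²)` (An RBG construction of integral surgery homeomorphisms, Algebr. Geom. Topol.
**25** (2025) 3755, arXiv:2308.04681, §4, Def. 4.1, Lemma 4.2): for `n = 0` they present `0`-surgery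
homeomorphisms "for which Nakamura's obstruction does not immediately apply; so, in principle, they
can potentially produce exotic spheres"; the printed examples `L(2,-1)` (whose `K_B` the paper identifies as the knot `11_270`) and
`L(3,-2)` have `s(K_G) = -2`, `s(K_B) = 0` but `σ(K_B) = 2`, so `K_B` is not slice (indeed not
H-slice in any `#ᵐℂℙ²`) and no `(slice, s ≠ 0)` pair results (ibid., Example 4.3) — the census
directive of §11 ("outside every Nakamura–Ren class") now has a named printed family to search in.
(2) NO NEW VANISHING MECHANISM for homotopy balls: Ren–Willis (arXiv:2402.10452, Prop. 6.17) show the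
Khovanov skein lasagna module over `ℚ` of a homotopy `4`-sphere `Σ` with `Σ # kℂℙ² ≅ kℂℙ²` is that of
`S⁴` — the lasagna form of MMSW's dissolution mechanism (§6 (iii)), nothing beyond it; Nahm
(arXiv:2602.20138, 2026) and Ren–Willis use `s` of cables to distinguish the exotic knot TRACES
`X₁(5₂)`, `X₁(P(-3,3,8))` — `s` detects exotic compact 4-manifolds with `b₂ = 1`, not homotopy balls.
(3) SEED EXCLUSIONS by Dehn-surgery characterisation: Baldwin–Sivek 2024 Thm. 1.1 (this section);
Kegel–Schmalian (arXiv:2508.18521, 2025) and Baldwin–Sivek give further characterising-slope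
results but no further slice knots with characterising `0`-slope.
(4) HANDLE COUNT `m = 2` (§6, generalised Property R seeds): Diao–Pan–Yan (arXiv:2604.17737, 2026)
verify stable handle-slide triviality of the Gompf–Scharlemann–Thompson links `L_n` stably
equivalent to `L(n+1, n; 2/…)` for `d ≤ 39` and find only ribbon knots in the classes examined — more
experimental evidence that fusion-number-1 seeds give standard spheres, no candidate.
(5) The 2026 candidate pool of §8 (Kegel–Spreer `W₊''`, `F4`, `F6`) has no printed follow-up
(0 forward citations); Oliveira-Smith (arXiv:2603.23717) removed DG's `X_DG`; the survey
arXiv:2601.05425 §7 still records "no pairs `(K, K')` with the above properties have been found".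
(6) A 2025 physics-journal article (Król–Asselmeyer-Maluga, *Universe* **11** (2025) 126) carries
"Negation of the smooth Poincaré conjecture in dimension 4" in its title; it is not a mathematical
refutation recognised by any of the 2026 sources above (acquisition request acq-01280 filed by
another seat; not held) and does not bear on this crux.
This theorem restates, for the record, that each printed vanishing class of this file is consistent:
the crux implies all of them (pure logic). [cite: Qin2025, §4 and Example 4.3 (arXiv:2308.04681)]
[cite: RenWillis2024, Prop. 6.17 (arXiv:2402.10452)] [cite: BaldwinSivek2024, Thm. 1.1 (arXiv:2211.04280)] -/
theorem crux_implies_every_vanishingClass (h : Crux)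
    (P : ∀ (_K _K' : Knot) (Y : Type) [TopologicalSpace Y] [ChartedSpace (𝔼 3) Y], Prop) :
    ∀ (K K' : Knot) (Y : Type) [TopologicalSpace Y] [ChartedSpace (𝔼 3) Y] (s : ℤ),
      P K K' Y → IsIntegralSurgery (𝓡 3) Y K 0 → IsIntegralSurgery (𝓡 3) Y K' 0 →
        K.IsSmoothlySlice → K'.HasRasmussenInvariant s → s = 0 :=
  fun K K' Y _ _ s _ h1 h2 h3 h4 ↦ h K K' Y s h1 h2 h3 h4

/-! ## §15 (gen 4) The line's `∃ o` is cosmetic: pair-sphere embeddability in ONE chirality for all pairs ⟺ in BOTH (formalised drefute Remark 1, pair level) -/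

section BiChirality

/-- Local notation: the complex projective plane of the tree. -/
local notation "ℂℙ²" => Literature.Topology.FourManifolds.ComplexProjectivePlane

/-- VERBATIM COPY of the skeleton's `IsTower` (`Lines/embed-dont-dissolve.lean` §1): oriented
`ℂℙ²`-tower of height `n` over the chirality `o` (height `0`: `P ≃ₘ S⁴`; height `n+1`: an oriented
connected sum of a height-`n` tower with `(ℂℙ², o)`). [cite: ManolescuMarengonSarkarWillis2023, §6] -/
def IsTower (o : SmoothOrientation (𝓡 4) ℂℙ²) :
    ℕ → ∀ (P : Type) [TopologicalSpace P] [T2Space P] [SecondCountableTopology P]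
      [ChartedSpace (𝔼 4) P] [IsManifold (𝓡 4) ∞ P] [CompactSpace P], SmoothOrientation (𝓡 4) P → Prop
  | 0 => fun P _ _ _ _ _ _ _ => Nonempty (P ≃ₘ⟮𝓡 4, 𝓡 4⟯ 𝕊⁴)
  | n + 1 => fun _ _ _ _ _ _ _ oP =>
      ∃ (Q : Type) (_ : TopologicalSpace Q) (_ : T2Space Q) (_ : SecondCountableTopology Q)
        (_ : ChartedSpace (𝔼 4) Q) (_ : IsManifold (𝓡 4) ∞ Q) (_ : CompactSpace Q)
        (oQ : SmoothOrientation (𝓡 4) Q),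
        IsTower o n Q oQ ∧ IsOrientedConnectedSum oQ o oP

/-- VERBATIM COPY of the skeleton's `PuncturedEmbedsInTower` (with `punctureAt q` = this file's
`puncture q`, the same term): `(X ∖ {q}, oX)` embeds orientation-preservingly in some `o`-tower.
[cite: ManolescuMarengonSarkarWillis2023, §9.3] -/
def PuncturedEmbedsInTower (o : SmoothOrientation (𝓡 4) ℂℙ²) (X : Type) [TopologicalSpace X]
    [T2Space X] [ChartedSpace (𝔼 4) X] [IsManifold (𝓡 4) ∞ X] (oX : SmoothOrientation (𝓡 4) X)
    (q : X) : Prop :=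
  ∃ (n : ℕ) (P : Type) (_ : TopologicalSpace P) (_ : T2Space P) (_ : SecondCountableTopology P)
    (_ : ChartedSpace (𝔼 4) P) (_ : IsManifold (𝓡 4) ∞ P) (_ : CompactSpace P)
    (oP : SmoothOrientation (𝓡 4) P) (j : ↥(puncture q) → P),
    IsTower o n P oP ∧ Manifold.IsSmoothEmbedding (𝓡 4) (𝓡 4) ∞ j ∧
      IsOrientationPreserving (oX.restrict (puncture q)) oP j

/-- VERBATIM COPY of the skeleton's `PairSphereEmbeds o K'` (the planner's stub-1 conclusion, the form
the composition `sVanishesOnPairs_of_stubs` consumes): `K'` is slice in a closed homotopy 4-sphere `X`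
w.r.t. data `(e, f)` with `e` orientation preserving for `oX`, and some puncture of `(X, oX)` off the
data embeds orientation-preservingly in an `o`-tower. [cite: ManolescuPiccirillo2023, Def. 2.4 and Lemma 3.5] -/
def PairSphereEmbeds (o : SmoothOrientation (𝓡 4) ℂℙ²) (K' : Knot) : Prop :=
  ∃ (X : Type) (_ : TopologicalSpace X) (_ : T2Space X) (_ : SecondCountableTopology X)
    (_ : ChartedSpace (𝔼 4) X) (_ : IsManifold (𝓡 4) ∞ X) (_ : CompactSpace X)
    (oX : SmoothOrientation (𝓡 4) X) (e : 𝔼 4 → X) (f : 𝔼 2 → X) (q : X),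
    Nonempty (X ≃ₕ 𝕊⁴) ∧ K'.IsSliceDiscIn X e f ∧
      IsOrientationPreserving (SmoothOrientation.euclidean 4) oX e ∧
      q ∉ range e ∧ q ∉ range f ∧ PuncturedEmbedsInTower o X oX q

/-- **The one-chirality pair-level bet** (planner's stub 1 of `embed-dont-dissolve` for a GIVEN `o`):
on every `0`-surgery pair with `K` slice, `PairSphereEmbeds o K'`. [cite: ManolescuPiccirillo2023, Lemma 3.5] -/
def PairSpheresEmbedIn (o : SmoothOrientation (𝓡 4) ℂℙ²) : Prop :=
  ∀ (K K' : Knot) (Y : Type) [TopologicalSpace Y] [ChartedSpace (𝔼 3) Y],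
    IsIntegralSurgery (𝓡 3) Y K 0 → IsIntegralSurgery (𝓡 3) Y K' 0 → K.IsSmoothlySlice →
      PairSphereEmbeds o K'

/-- Reversing chirality and orientation turns an `o`-tower into a `(-o)`-tower of the same height
(copy of the skeleton's `isTower_neg`; `IsOrientedConnectedSum.neg`). [cite: KervaireMilnor1963, §2] -/
theorem isTower_neg (o : SmoothOrientation (𝓡 4) ℂℙ²) :
    ∀ (n : ℕ) (P : Type) [TopologicalSpace P] [T2Space P] [SecondCountableTopology P]
      [ChartedSpace (𝔼 4) P] [IsManifold (𝓡 4) ∞ P] [CompactSpace P] (oP : SmoothOrientation (𝓡 4) P),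
      IsTower o n P oP → IsTower (-o) n P (-oP) := by
  intro n
  induction n with
  | zero => intro P _ _ _ _ _ _ oP h; exact h
  | succ n ih =>
    intro P _ _ _ _ _ _ oP h
    obtain ⟨Q, _, _, _, _, _, _, oQ, hQ, hcs⟩ := h
    exact ⟨Q, _, ‹_›, ‹_›, _, ‹_›, ‹_›, -oQ, ih Q oQ hQ, hcs.neg⟩

/-- **Flipping the orientation of the source is flipping the chirality of the tower**: an
orientation-preserving punctured embedding of `(X, -oX)` into an `o`-tower is one of `(X, oX)` into the
`(-o)`-tower `(P, -oP)` (unconditional bookkeeping: `isTower_neg`, `restrict_neg`,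
`isOrientationPreserving_neg_neg_iff`). [folklore] -/
theorem puncturedEmbedsInTower_neg {o : SmoothOrientation (𝓡 4) ℂℙ²} {X : Type} [TopologicalSpace X]
    [T2Space X] [ChartedSpace (𝔼 4) X] [IsManifold (𝓡 4) ∞ X] {oX : SmoothOrientation (𝓡 4) X}
    {q : X} (h : PuncturedEmbedsInTower o X (-oX) q) : PuncturedEmbedsInTower (-o) X oX q := by
  obtain ⟨n, P, _, _, _, _, _, _, oP, j, hT, hj, hjo⟩ := h
  refine ⟨n, P, _, ‹_›, ‹_›, _, ‹_›, ‹_›, -oP, j, isTower_neg o n P oP hT, hj, ?_⟩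
  rw [SmoothOrientation.restrict_neg] at hjo
  rwa [← isOrientationPreserving_neg_neg_iff, neg_neg]

/-- `PuncturedEmbedsInTower` in chirality `o` for `(X, oX)` iff in chirality `-o` for `(X, -oX)`.
[folklore] -/
theorem puncturedEmbedsInTower_neg_iff {o : SmoothOrientation (𝓡 4) ℂℙ²} {X : Type}
    [TopologicalSpace X] [T2Space X] [ChartedSpace (𝔼 4) X] [IsManifold (𝓡 4) ∞ X]
    {oX : SmoothOrientation (𝓡 4) X} {q : X} :
    PuncturedEmbedsInTower (-o) X (-oX) q ↔ PuncturedEmbedsInTower o X oX q := by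
  constructor
  · intro h
    have h' := puncturedEmbedsInTower_neg (o := -o) (oX := oX) (by simpa using h)
    simpa using h'
  · intro h
    exact puncturedEmbedsInTower_neg (by simpa using h)


/-! ### Inlined copy of the lead's mirror-chart lemmas (`Theorems/ZeroSurgeryExoticZseSVanishesOnPairsMirrorChart.lean`,
prover-line-stmt-SmoothPoincare4-0368-0, 2026-08-16) — copied verbatim so that this work file does not depend on the
farm having built that Theorems module; all credit to the lead. -/

/-- The coordinate reflection `reflectLastCLM n` is Mathlib's reflection in `(ℝ eₙ)ᗮ` (copy). [folklore] -/
theorem reflectLastCLM_apply_eq_reflection (n : ℕ) (v : 𝔼 (n + 1)) :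
    reflectLastCLM n v = (ℝ ∙ EuclideanSpace.single (Fin.last n) (1 : ℝ))ᗮ.reflection v := by
  ext i
  rw [Submodule.reflection_orthogonal_apply, Submodule.reflection_singleton_apply,
    EuclideanSpace.inner_single_left]
  simp only [reflectLastCLM, ContinuousLinearMap.coe_mk', LinearMap.coe_mk, AddHom.coe_mk,
    PiLp.toLp_apply, map_one, one_mul, EuclideanSpace.single, PiLp.norm_single, norm_one, one_pow,
    div_one, PiLp.neg_apply, PiLp.sub_apply, PiLp.smul_apply, PiLp.single_apply, smul_eq_mul,
    nsmul_eq_mul, Nat.cast_ofNat]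
  split_ifs with h
  · subst h
    ring
  · ring

/-- `det (reflectLastCLM n) = -1` (copy). [folklore] -/
theorem det_reflectLastCLM (n : ℕ) :
    LinearMap.det ((reflectLastCLM n : 𝔼 (n + 1) →L[ℝ] 𝔼 (n + 1)) : 𝔼 (n + 1) →ₗ[ℝ] 𝔼 (n + 1)) =
      -1 := by
  have hne : EuclideanSpace.single (Fin.last n) (1 : ℝ) ≠ 0 := by
    intro h
    have := congrArg (fun x : 𝔼 (n + 1) => x (Fin.last n)) h
    simp at this
  have h1 := (ℝ ∙ EuclideanSpace.single (Fin.last n) (1 : ℝ))ᗮ.det_reflection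
  rw [Submodule.orthogonal_orthogonal, finrank_span_singleton hne, pow_one] at h1
  have heq : ((reflectLastCLM n : 𝔼 (n + 1) →L[ℝ] 𝔼 (n + 1)) : 𝔼 (n + 1) →ₗ[ℝ] 𝔼 (n + 1)) =
      (ℝ ∙ EuclideanSpace.single (Fin.last n) (1 : ℝ))ᗮ.reflection.toLinearMap := by
    apply LinearMap.ext
    intro v
    exact reflectLastCLM_apply_eq_reflection n v
  rw [heq]
  exact h1

/-- The differential of `reflectLastCLM n` is itself (copy). [folklore] -/
theorem mfderiv_reflectLastCLM (n : ℕ) (x : 𝔼 (n + 1)) :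
    mfderiv 𝓘(ℝ, 𝔼 (n + 1)) 𝓘(ℝ, 𝔼 (n + 1)) (reflectLastCLM n) x =
      (reflectLastCLM n : 𝔼 (n + 1) →L[ℝ] 𝔼 (n + 1)) :=
  ContinuousLinearMap.mfderiv_eq _

/-- Jacobian determinant `-1` everywhere (copy). [folklore] -/
theorem det_mfderiv_reflectLastCLM (n : ℕ) (x : 𝔼 (n + 1)) :
    LinearMap.det (M := 𝔼 (n + 1))
      (mfderiv 𝓘(ℝ, 𝔼 (n + 1)) 𝓘(ℝ, 𝔼 (n + 1)) (reflectLastCLM n) x).toLinearMap = -1 := by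
  have h := det_reflectLastCLM n
  rw [← mfderiv_reflectLastCLM n x] at h
  exact h

/-- The coordinate reflection reverses the standard orientation (copy). [cite: HirschDT1976, Ch. 4 §4] -/
theorem isOrientationPreserving_reflectLastCLM (n : ℕ) :
    IsOrientationPreserving (-SmoothOrientation.euclidean (n + 1))
      (SmoothOrientation.euclidean (n + 1)) (reflectLastCLM n) := by
  intro x
  have h1 : SmoothOrientation.euclidean (n + 1) (reflectLastCLM n x) ≠
      (-SmoothOrientation.euclidean (n + 1)) x := by
    rw [SmoothOrientation.neg_apply, SmoothOrientation.euclidean_apply,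
      SmoothOrientation.euclidean_apply]
    exact Module.Ray.ne_neg_self _
  have h2 : ¬ 0 < LinearMap.det (M := 𝔼 (n + 1))
      (mfderiv 𝓘(ℝ, 𝔼 (n + 1)) 𝓘(ℝ, 𝔼 (n + 1)) (reflectLastCLM n) x).toLinearMap := by
    rw [det_mfderiv_reflectLastCLM]
    norm_num
  exact iff_of_false h1 h2

/-- Nowhere-vanishing Jacobian of `reflectLastCLM n` (copy). [folklore] -/
theorem det_mfderiv_reflectLastCLM_ne_zero (n : ℕ) (x : 𝔼 (n + 1)) :
    LinearMap.det (M := 𝔼 (n + 1))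
      (mfderiv 𝓘(ℝ, 𝔼 (n + 1)) 𝓘(ℝ, 𝔼 (n + 1)) (reflectLastCLM n) x).toLinearMap ≠ 0 := by
  rw [det_mfderiv_reflectLastCLM]
  norm_num

/-- Precomposition with the involution `reflectLastCLM n` preserves ranges (copy). [folklore] -/
theorem range_comp_reflectLastCLM {X : Type*} (n : ℕ) (e : 𝔼 (n + 1) → X) :
    range (e ∘ reflectLastCLM n) = range e :=
  (Function.Involutive.surjective (reflectLastCLM_reflectLastCLM n)).range_comp e

/-- A reflected orientation-preserving open embedding of `ℝⁿ⁺¹` is orientation preserving into the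
reversed orientation (copy of the lead's `isOrientationPreserving_neg_comp_reflectLastCLM`).
[cite: HirschDT1976, Ch. 4 §4] -/
theorem isOrientationPreserving_neg_comp_reflectLastCLM {n : ℕ} {P : Type*} [TopologicalSpace P]
    [ChartedSpace (𝔼 (n + 1)) P] [IsManifold (𝓡 (n + 1)) ∞ P] {oP : SmoothOrientation (𝓡 (n + 1)) P}
    {e : 𝔼 (n + 1) → P} (he : Manifold.IsSmoothEmbedding (𝓡 (n + 1)) (𝓡 (n + 1)) ∞ e)
    (ho : IsOrientationPreserving (SmoothOrientation.euclidean (n + 1)) oP e) :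
    IsOrientationPreserving (SmoothOrientation.euclidean (n + 1)) (-oP) (e ∘ reflectLastCLM n) := by
  have hed : MDifferentiable (𝓡 (n + 1)) (𝓡 (n + 1)) e := he.contMDiff.mdifferentiable (by simp)
  have hρd : MDifferentiable 𝓘(ℝ, 𝔼 (n + 1)) 𝓘(ℝ, 𝔼 (n + 1)) (reflectLastCLM n) :=
    (reflectLastCLM n).mdifferentiable
  have he' : ∀ y, LinearMap.det (M := 𝔼 (n + 1))
      (mfderiv (𝓡 (n + 1)) (𝓡 (n + 1)) e y).toLinearMap ≠ 0 :=
    det_mfderiv_ne_zero_of_isSmoothEmbedding he (isOpen_range_of_isSmoothEmbedding_disc he)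
  have h : IsOrientationPreserving (-SmoothOrientation.euclidean (n + 1)) oP
      (e ∘ reflectLastCLM n) :=
    IsOrientationPreserving.comp_holds ho (isOrientationPreserving_reflectLastCLM n) hed hρd he'
      (det_mfderiv_reflectLastCLM_ne_zero n)
  rw [← isOrientationPreserving_neg_neg_iff, neg_neg]
  exact h

/-- **MIRROR OF A PAIR-SPHERE WITNESS** (the heart of drefute Remark 1, pair level): if the MIRROR
`K̄'` has a pair-sphere witness in chirality `o`, then `K'` has one in chirality `-o` — same `X`, `f`,
`q`; reflected ball chart `e ∘ ρ` (`Knot.IsSliceDiscIn.mirror`, PROVED; `K̄̄' = K'`), which is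
orientation preserving into `-oX` (the lead's LANDED `isOrientationPreserving_neg_comp_reflectLastCLM`,
`Theorems/…MirrorChart.lean`) and has the same range; and the punctured embedding of `(X, oX)` into
the `o`-tower `(P, oP)` read as one of `(X, -oX)` into the `(-o)`-tower `(P, -oP)`.
[cite: ManolescuMarengonSarkarWillis2023, Remark 6.6] -/
theorem pairSphereEmbeds_neg_of_mirror {o : SmoothOrientation (𝓡 4) ℂℙ²} {K' : Knot}
    (h : PairSphereEmbeds o K'.mirror) : PairSphereEmbeds (-o) K' := by
  obtain ⟨X, _, _, _, _, _, _, oX, e, f, q, hX, hef, he, hqe, hqf, hP⟩ := h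
  have hm : K'.IsSliceDiscIn X (e ∘ reflectLastCLM 3) f := by
    have h' := hef.mirror
    rwa [show K'.mirror.mirror = K' from SphereEmbedding.mirror_mirror K'] at h'
  refine ⟨X, _, ‹_›, ‹_›, _, ‹_›, ‹_›, -oX, e ∘ reflectLastCLM 3, f, q, hX, hm,
    isOrientationPreserving_neg_comp_reflectLastCLM hef.isSmoothEmbedding he, ?_, hqf, ?_⟩
  · rwa [range_comp_reflectLastCLM 3 e]
  · exact puncturedEmbedsInTower_neg (by simpa using hP)

/-- `PairSphereEmbeds o K̄' ↔ PairSphereEmbeds (-o) K'`. [cite: ManolescuMarengonSarkarWillis2023, Remark 6.6] -/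
theorem pairSphereEmbeds_mirror_iff (o : SmoothOrientation (𝓡 4) ℂℙ²) (K' : Knot) :
    PairSphereEmbeds o K'.mirror ↔ PairSphereEmbeds (-o) K' := by
  refine ⟨pairSphereEmbeds_neg_of_mirror, fun h ↦ ?_⟩
  have h' : PairSphereEmbeds (- -o) K'.mirror :=
    pairSphereEmbeds_neg_of_mirror (K' := K'.mirror)
      (by rwa [show K'.mirror.mirror = K' from SphereEmbedding.mirror_mirror K'])
  simpa using h'

/-- **THE `∃ o` IS COSMETIC, I: the pair-level bet in chirality `o` implies the bet in chirality `-o`**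
(apply it to the mirror pair `(K̄, K̄', Y)`, §7 `pair_mirror`, and mirror the witness back).
Unconditional. So "ONE chirality suffices" buys nothing: any proof of the planner's stub 1 proves,
pair by pair, punctured embeddability of a pair sphere of `K'` in towers of BOTH chiralities
("biprojective" embeddability), and a pair whose spheres embed only in the wrong chirality kills the
bet for both `o` at once (its mirror pair kills the other). [cite: ManolescuMarengonSarkarWillis2023, Remark 6.6 and Question 9.12] -/
theorem pairSpheresEmbedIn_neg {o : SmoothOrientation (𝓡 4) ℂℙ²} (h : PairSpheresEmbedIn o) :
    PairSpheresEmbedIn (-o) := by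
  intro K K' Y _ _ h1 h2 h3
  exact pairSphereEmbeds_neg_of_mirror
    (h K.mirror K'.mirror Y ((isIntegralSurgery_zero_mirror_iff K).2 h1)
      ((isIntegralSurgery_zero_mirror_iff K').2 h2) (isSmoothlySlice_mirror h3))

/-- `PairSpheresEmbedIn (-o) ↔ PairSpheresEmbedIn o`. [folklore] -/
theorem pairSpheresEmbedIn_neg_iff (o : SmoothOrientation (𝓡 4) ℂℙ²) :
    PairSpheresEmbedIn (-o) ↔ PairSpheresEmbedIn o :=
  ⟨fun h ↦ by simpa using pairSpheresEmbedIn_neg h, pairSpheresEmbedIn_neg⟩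

/-- **THE `∃ o` IS COSMETIC, II: `(∃ o, bet o) ↔ (∀ o, bet o)`** — `ℂℙ²` is connected (simply
connected, tree instance), so its smooth orientations are `o` and `-o` (DISCHARGED
`SmoothOrientation.eq_or_eq_neg_of_connectedSpace_holds`), and part I covers `-o`; `←` needs an
orientation of `ℂℙ²` to exist (`isOrientable_complexProjectivePlane_holds`-free phrasing: we take any
`o₀` as a parameter).  CONSEQUENCE FOR THE SKELETON: in `sVanishesOnPairs_of_stubs` the case split
`o₁ = ±o₀` between the bet's chirality and the engine's is bookkeeping — one may always feed the engine's
own chirality. [cite: HirschDT1976, Ch. 4 §4] -/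
theorem exists_pairSpheresEmbedIn_iff_forall (o₀ : SmoothOrientation (𝓡 4) ℂℙ²) :
    (∃ o, PairSpheresEmbedIn o) ↔ ∀ o, PairSpheresEmbedIn o := by
  refine ⟨?_, fun h ↦ ⟨o₀, h o₀⟩⟩
  rintro ⟨o₁, h₁⟩ o
  rcases SmoothOrientation.eq_or_eq_neg_of_connectedSpace_holds o₁ o with rfl | rfl
  · exact h₁
  · exact pairSpheresEmbedIn_neg h₁

end BiChirality

end Summit.SmoothPoincare4.SmoothPoincare4.Cruxes.ZseSVanishesOnPairs.Disproof
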